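import Literature.Barriers.ABC.BakerMethodBoundsKummerArchProofs
import Literature.Barriers.ABC.BakerMethodBoundsSubexpProofs
import Mathlib.NumberTheory.Chebyshev
import HarnessLib

/-!
# Proofs for `BakerMethodBounds`, VII: the printed proof line of Stewart–Yu 1991

`Literature/Barriers/ABC/BakerMethodBoundsStewartYu1991LineProofs.lean` — proofs companion of
the barrier file `Literature/Barriers/ABC/BakerMethodBounds.lean` (theorems only: no
definition, no named fact), for the named fact
`Literature.Barriers.ABC.stewartYu1991_upperBound`: for every `ε > 0` there are `κ(ε), c₀(ε)`
with `log c ≤ κ(ε) · R^{2/3+ε}` for every abc triple with `c ≥ c₀(ε)`, `R = rad(abc)`.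

**The source, now read.** C. L. Stewart, Kunrui Yu, *On the abc conjecture*, Math. Ann. 291
(1991), 225–230 (open scan: GDZ Göttingen, `PPN235181684_0291/LOG_0021`; EuDML 164860;
zbMATH 0761.11030). Its Theorem (p. 226): there is an effectively computable `c > 0` such that
for all positive integers `x, y, z` with `(x, y, z) = 1`, `z > 2`, `x + y = z`:
`log z < G^{2/3 + c/log log G}`, `G = ∏_{p ∣ xyz} p`; and "in particular, for each `ε > 0` there
exists a number `c₄(ε)` … such that `z < exp(c₄(ε) G^{2/3+ε})`" — the vendored statement is this
corollary (with a harmless threshold `c₀`), hence faithful [cite: StewartYu1991, Theorem (p. 226)].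

**What this file proves.** The paper is a five-page deduction from two lower bounds for linear
forms in logarithms of quality `nⁿ` (NOT `Kⁿ`):

* Lemma 1 (p. 226) = Yu 1990, *Linear forms in `p`-adic logarithms II*, Compositio Math. 74,
  Corollary 2.3 (p. 32; for `n = 1` Lemma 1.4), in `K = ℚ(ζ₄)` (`p > 2`) resp. `ℚ(ζ₆)` (`p = 2`)
  under the Kummer condition `[K(α₀^{1/q}, α₁^{1/q}, …, αₙ^{1/q}) : K] = q^{n+1}`:
  `ord_℘ Θ < (c₅ n)ⁿ p² · log B · log log A · log A₁ ⋯ log Aₙ` for `Θ = α₁^{b₁}⋯αₙ^{bₙ} − 1 ≠ 0`,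
  `|αᵢ| ≤ Aᵢ`, `Aᵢ ≥ 4`, `|bᵢ| ≤ B`, `B ≥ 3` [cite: StewartYu1991, Lemma 1]
  [cite: Yu1990, Corollary 2.3 (p. 32)];
* Lemma 2 (p. 227) = Waldschmidt 1980, Acta Arith. 37, Proposition 3.8 (p. 274:
  `C₁(n, q) ≤ 2^{6n+24} n^{n+4} q^{3n+3}`) under the Kummer condition
  `[ℚ(√α₁, …, √αₙ) : ℚ] = 2ⁿ`: `|Λ| > exp(−(c₆ n)ⁿ log B (log log A)² log A₁⋯log Aₙ)`
  [cite: StewartYu1991, Lemma 2] [cite: Waldschmidt1980, Prop 3.8 (p. 274)];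
* Lemma 3 (p. 227): the Kummer conditions hold for distinct primes (over `ℚ`; over `ℚ(ζ₄)`
  with `2` replaced by `1 + i`); Lemma 4 (p. 227): `∏_{j ≤ r} pⱼ/log pⱼ > ((r+3)/c₇)^{r+3}`
  (Chebyshev);
* §3 (pp. 228–230): (8) `ord_p ≤ log z/log 2`; (9) the MAX-ORD DEVICE
  `log z = ∑_{p ∣ z} ord_p z · log p ≤ (max_{p ∣ z} ord_p z) · log G`; (10)–(12) the congruences
  `ord_p z ≤ ord_p((x/y)⁴ − 1)` etc. bounded by Lemma 1 with the primes of the other two members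
  as generators; (13), (14) (`log y > log z/4`), (16) (`x ≥ √y`, or Lemma 2 for
  `0 < log(z/y) < √2/√z` when `x < √y`); (17) the product
  `(log z/4 log log z)³ < (c₁₄ r)^{2r} (p_x p_y p_z)² (∏_{p ∣ xyz} log p)² (log G)⁶`;
  (18) Lemma 4 applied to the primes other than the three largest `p_x, p_y, p_z` absorbs
  `r^{2r} (∏ log p)²` AND `(p_x p_y p_z)²` into `G²`: `(log z/4 log log z)³ < c₁₆^r G² (log G)^{12}`,
  and `c₁₆^r < G^{c₁₇/log log G}`.

Everything from Lemma 3 on is PROVED here; Lemmas 1 and 2 (theories absent from Mathlib) enter as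
explicit binders, exactly as the other inputs of this cluster:

* `stewartYu1991_of_yu1990_waldschmidt1980 :` (Y) `→` (W) `→ stewartYu1991_upperBound`, where
  (Y) `hY` is Lemma 1 in the form in which (10)–(12) apply it — for a prime `p`, a non-empty
      finite set `S` of primes not containing `p`, `e : S → ℤ` with `|e_q| ≤ B`, `B ≥ 3`,
      `∏ q^{e_q} ≠ 1`:
      `ord_p(∏_{q ∈ S} q^{e_q} − 1) < (c₅ #S)^{#S} · p² · log B · log log A · ∏_{q ∈ S} log max(4,q)`,
      `A = max(4, max S)` (generators `q` resp. `1 + i`, `Aᵢ = max(4, qᵢ)`; the fourth powers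
      of the paper, `u − 1 ∣ u⁴ − 1` and `2⁴ = (1 + i)⁸`, change `B` by a factor `≤ 8`, and
      `log(8B) ≤ 3 log B` for `B ≥ 3` is absorbed in `c₅`);
  (W) `hW₂` is VERBATIM the binder of `BakerMethodBoundsKummerArchProofs` (Waldschmidt's
      Proposition 3.8 for `K = ℚ`, `q = 2`, at `E = 2`) for a constant function `Cw` with
      `0 ≤ Cw(n) ≤ (c₆ n)ⁿ`; `stewartYu1991_of_yu1990_waldschmidt1980_explicit` fixes
      `Cw(n) = 2^{9n+27} n^{n+4}` (`≤ (2^{40} n)ⁿ`, `waldschmidt_constant_le`), Waldschmidt's own.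
* `log_pow_three_le_of_yu1990_waldschmidt1980`: the paper's (17)–(18) in the form
  `(log c)³ ≤ 23040000 · ((600 C)²)^r · G² · (log G)^{12} · (log(6 log c))³`
  (`r = ω(abc)`, `C = 2 max{1, |c₅|, |c₆|}`), for `a ≤ b`, `c ≥ 3`.

Relation to files I–VI. `BakerMethodBoundsHalfExponentProofs` (file V) proves the same named
fact from the `p`-adic clause of QUALITY `Kⁿ` alone (Yu 2007; two routes, exponent `1/2`). With
inputs of quality `nⁿ` that accounting fails (`nⁿ ∏ log q ≈ rad^{1+o(1)}` on the primorials), and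
the printed proof needs (a) the max-ord device (one prime per member, at most its largest prime,
hence the cost `p²` only through `(p_x p_y p_z)²`), (b) all THREE members, the third through the
archimedean Lemma 2 when `x < √y`, and (c) Lemma 4 without the three top primes. So the
undischarged inputs of `stewartYu1991_upperBound` along the printed line are Yu 1990 (Cor. 2.3,
with Lemma 1.4 and the Kummer set-up of Lemma 3) and Waldschmidt 1980 (Prop. 3.8) over `ℚ` — both
`nⁿ`-quality theorems of Baker's method, neither in Mathlib.

## Contents (all proved)

* §LemmaFour: `card_le_of_forall_le_prime` (Chebyshev, from Mathlib's
  `Chebyshev.pi_le_log4_mul_div`: a set of primes with maximum `P` has `≤ 5P/log max(4,P)`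
  elements), `card_pow_card_mul_prod_log_le` (Lemma 4: `#S^{#S} ∏_{q ∈ S} log max(4,q) ≤ 15^{#S} ∏ q`,
  by `Finset.induction_on_max`), `pow_self_mul_prod_log_le` (`k^k`-version for `k ≤ #S + 3`,
  constant `600`), `exists_pow_le_mul_rpow` (`r^r ≤ c^{r+1} G ⟹ D^r ≤ A(ε) G^ε`).
* §ArchSorted: `arch_lower_bound_primes_sorted` — Lemma 2 + Lemma 3 for `Λ = ∑_{q ∈ L} e_q log q`
  from `hW₂`, the generators sorted increasingly with `V_q = log max(4, q)` (monotone `V`, so the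
  bound carries `∏ log max(4,q)` and not a power of `log max L`); Kummer condition by
  `finrank_adjoin_sqrt_eq_two_pow` and `not_isSquare_prod_snoc` of file VI.
* §LargestPrime: `P(n) = largestPrimeFactor n` (of `BakerMethodBounds`; `le_largestPrimeFactor_of_mem_primeFactors`
  of `BakerMethodBoundsSubexpProofs`) as the subset `{P(n)} ∩ primeFactors n` and the
  absorption `pow_card_mul_prod_top_mul_prod_log_le`
  (`#S^{#S} · ∏_{T} q · ∏_{S} log max(4,q) ≤ 600^{#S+1} · ∏_{S} q · Λ³` for `T ⊆ S`, `#T ≤ 3`).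
* §Routes: (9) `log_le_mul_log_prod_primeFactors`; the congruences `padicValRat_route_b` (11),
  `padicValRat_route_a` (12), `le_padicValRat_route_c` (10, with the square `(x/y)² − 1`);
  `abs_expDiff_le` (`|e_q| ≤ 3 log c`); non-triviality of `u/v` and `(a/b)²`.
* §Endgame: `le_of_pow_three_le_log` (`u³ ≤ K³ G^{3θ} log(6u)³ ⟹ u ≤ (6K/ε)^{1/(1−ε)} G^{θ/(1−ε)}`).
* §ThreeRoutes: `log_le_of_padicRoute` ((9) + Lemma 1 at the primes of a member),
  `log_le_of_archRoute` ((15)–(16) from Lemma 2).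
* §Main, §Theorem: `pow_three_le_of_routes` (17), `card_pow_card_le_rad`,
  `log_pow_three_le_of_yu1990_waldschmidt1980` (18), `stewartYu1991_of_yu1990_waldschmidt1980`,
  `stewartYu1991_of_yu1990_waldschmidt1980_explicit`.

## References

* [StewartYu1991] C. L. Stewart, K. Yu, *On the abc conjecture*, Math. Ann. 291 (1991), 225–230,
  doi:10.1007/bf01445201 — Theorem (p. 226), Lemmas 1–4 (pp. 226–227), §3 (8)–(18)
  (pp. 228–230); open scan GDZ `PPN235181684_0291/LOG_0021`, EuDML 164860.
* [Yu1990] K. Yu, *Linear forms in `p`-adic logarithms II*, Compositio Math. 74 (1990), 15–113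
  (Numdam `CM_1990__74_1_15_0`) — Corollary 2.3 (p. 32), Lemma 1.4 (p. 23), Corollary 2 (p. 20).
* [Waldschmidt1980] M. Waldschmidt, *A lower bound for linear forms in logarithms*, Acta Arith.
  37 (1980), 257–283, doi:10.4064/aa-37-1-257-283 — Theorem (pp. 257–258), Prop. 3.8 (p. 274).
* [Waldschmidt2014] M. Waldschmidt, *Lecture on the abc conjecture and some of its consequences*,
  Springer Proc. Math. Stat. 98 (2015), §2 — the vendored form.
* [EvertseGyory2015] J.-H. Evertse, K. Győry, *Unit Equations in Diophantine Number Theory*,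
  CUP 2015 — Thm 3.2.7 (p. 62) (Yu 2007, the `Kⁿ`-quality input of file V, for comparison).
-/

noncomputable section

open Finset Real Height
open Literature.NumberTheory.DiophantineGeometry
open Literature.NumberTheory.DiophantineGeometry.Dioph
open Literature.NumberTheory.DiophantineGeometry.Pasten

namespace Literature.Barriers.ABC

/-! ### Lemma 4 of the paper: Chebyshev beats `n^n` -/

section LemmaFour

/-- **Chebyshev for a set of primes:** a finite set of primes with largest element `P` has at
most `5 P / log max(4, P)` elements (`π(x) ≤ 2 log 4 · x/log x + √x`, Mathlib's
`Chebyshev.pi_le_log4_mul_div`). [cite: StewartYu1991, Lemma 4 (proof)] -/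
theorem card_le_of_forall_le_prime {S : Finset ℕ} (hS : ∀ q ∈ S, q.Prime) {P : ℕ} (hP : P.Prime)
    (hle : ∀ q ∈ S, q ≤ P) :
    (S.card : ℝ) ≤ 5 * P / Real.log ((max 4 P : ℕ) : ℝ) := by
  have hP2 : (2 : ℝ) ≤ P := by exact_mod_cast hP.two_le
  have hsub : S ⊆ Nat.primesLE P := by
    intro q hq
    rw [Nat.mem_primesLE]
    exact ⟨hle q hq, hS q hq⟩
  have hcardle : S.card ≤ Nat.primeCounting P := by
    rw [← Nat.primesLE_card_eq_primeCounting]; exact Finset.card_le_card hsub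
  have hlog4 : 0 < Real.log ((max 4 P : ℕ) : ℝ) := by
    apply Real.log_pos; exact_mod_cast (show 1 < max 4 P from lt_of_lt_of_le (by norm_num) (le_max_left _ _))
  rw [le_div_iff₀ hlog4]
  by_cases h4 : P < 4
  · -- `S ⊆ primesLE 3`, so `#S ≤ 2`, and `log 4 ≤ 3`
    have hmax : (max 4 P : ℕ) = 4 := max_eq_left h4.le
    have hcard2 : S.card ≤ 2 := by
      have h3 : Nat.primeCounting P ≤ Nat.primeCounting 3 := Nat.monotone_primeCounting (by omega)
      have : Nat.primeCounting 3 = 2 := by decide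
      omega
    have hlog43 : Real.log ((4 : ℕ) : ℝ) ≤ 3 := by
      have := Real.log_le_sub_one_of_pos (show (0 : ℝ) < 4 by norm_num)
      push_cast; linarith
    rw [hmax] at hlog4 ⊢
    have hc : (S.card : ℝ) ≤ 2 := by exact_mod_cast hcard2
    calc (S.card : ℝ) * Real.log ((4 : ℕ) : ℝ) ≤ 2 * 3 :=
          mul_le_mul hc hlog43 hlog4.le (by norm_num)
      _ ≤ 5 * P := by linarith
  · push Not at h4
    have hmax : (max 4 P : ℕ) = P := max_eq_right h4
    rw [hmax]
    have hP1 : (1 : ℝ) < P := by linarith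
    have hπ := Chebyshev.pi_le_log4_mul_div hP1
    rw [Nat.floor_natCast] at hπ
    have hlogP : 0 < Real.log P := Real.log_pos hP1
    have hsqrt : Real.log (Real.sqrt P) = Real.log P / 2 := by
      rw [Real.log_sqrt (by linarith)]
    rw [hsqrt] at hπ
    -- `√P ≤ 2 P / log P` since `log P ≤ 2 √P`
    have hsq : Real.sqrt (P : ℝ) * Real.log P ≤ 2 * P := by
      have h1 : Real.log (P : ℝ) ≤ (P : ℝ) ^ (1 / 2 : ℝ) / (1 / 2) :=
        Real.log_le_rpow_div (by linarith) (by norm_num)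
      rw [← Real.sqrt_eq_rpow] at h1
      have hs0 : 0 ≤ Real.sqrt (P : ℝ) := Real.sqrt_nonneg _
      have hss : Real.sqrt (P : ℝ) * Real.sqrt P = P := Real.mul_self_sqrt (by linarith)
      calc Real.sqrt (P : ℝ) * Real.log P ≤ Real.sqrt P * (Real.sqrt P / (1 / 2)) :=
            mul_le_mul_of_nonneg_left h1 hs0
        _ = 2 * (Real.sqrt (P : ℝ) * Real.sqrt P) := by ring
        _ = 2 * P := by rw [hss]
    have hlog4le : Real.log 4 ≤ 3 / 2 := by
      have h := Real.log_two_lt_d9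
      have : Real.log 4 = 2 * Real.log 2 := by
        rw [show (4 : ℝ) = 2 ^ 2 by norm_num, Real.log_pow]; norm_num
      rw [this]; linarith
    have hc : (S.card : ℝ) ≤ Nat.primeCounting P := by exact_mod_cast hcardle
    calc (S.card : ℝ) * Real.log P ≤ (Real.log 4 * P / (Real.log P / 2) + Real.sqrt P) * Real.log P :=
          mul_le_mul_of_nonneg_right (hc.trans hπ) hlogP.le
      _ = 2 * Real.log 4 * P + Real.sqrt P * Real.log P := by field_simp
      _ ≤ 2 * (3 / 2) * P + 2 * P := by gcongr
      _ = 5 * P := by ring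

/-- `(m+1)^m ≤ e · m^m` (`(1 + 1/m)^m ≤ e`). [folklore] -/
theorem succ_pow_le_exp_mul_pow (m : ℕ) : ((m : ℝ) + 1) ^ m ≤ Real.exp 1 * (m : ℝ) ^ m := by
  rcases Nat.eq_zero_or_pos m with rfl | hm
  · simp
  have hm0 : (0 : ℝ) < m := by exact_mod_cast hm
  have h1 : (m : ℝ) + 1 = m * (1 + 1 / m) := by field_simp
  have h2 : (1 + 1 / (m : ℝ)) ^ m ≤ Real.exp 1 := by
    have h3 : (1 + 1 / (m : ℝ)) ≤ Real.exp (1 / m) := by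
      have := Real.add_one_le_exp (1 / (m : ℝ)); linarith
    calc (1 + 1 / (m : ℝ)) ^ m ≤ Real.exp (1 / m) ^ m :=
          pow_le_pow_left₀ (by positivity) h3 m
      _ = Real.exp 1 := by rw [← Real.exp_nat_mul]; field_simp
  rw [h1, mul_pow]
  calc (m : ℝ) ^ m * (1 + 1 / (m : ℝ)) ^ m ≤ (m : ℝ) ^ m * Real.exp 1 :=
        mul_le_mul_of_nonneg_left h2 (by positivity)
    _ = Real.exp 1 * (m : ℝ) ^ m := by ring

/-- `(m+3)^m ≤ e³ · m^m` (`(1 + 3/m)^m ≤ e³`). [folklore] -/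
theorem add_three_pow_le_exp_mul_pow (m : ℕ) : ((m : ℝ) + 3) ^ m ≤ Real.exp 3 * (m : ℝ) ^ m := by
  rcases Nat.eq_zero_or_pos m with rfl | hm
  · simp
  have hm0 : (0 : ℝ) < m := by exact_mod_cast hm
  have h1 : (m : ℝ) + 3 = m * (1 + 3 / m) := by field_simp
  have h2 : (1 + 3 / (m : ℝ)) ^ m ≤ Real.exp 3 := by
    have h3 : (1 + 3 / (m : ℝ)) ≤ Real.exp (3 / m) := by
      have := Real.add_one_le_exp (3 / (m : ℝ)); linarith
    calc (1 + 3 / (m : ℝ)) ^ m ≤ Real.exp (3 / m) ^ m :=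
          pow_le_pow_left₀ (by positivity) h3 m
      _ = Real.exp 3 := by rw [← Real.exp_nat_mul]; field_simp
  rw [h1, mul_pow]
  calc (m : ℝ) ^ m * (1 + 3 / (m : ℝ)) ^ m ≤ (m : ℝ) ^ m * Real.exp 3 :=
        mul_le_mul_of_nonneg_left h2 (by positivity)
    _ = Real.exp 3 * (m : ℝ) ^ m := by ring

/-- **Lemma 4 (Chebyshev beats `n^n`), product form.** For a finite set `S` of primes,
`#S^{#S} · ∏_{q ∈ S} log max(4, q) ≤ 15^{#S} · ∏_{q ∈ S} q`. Stewart–Yu state it as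
`∏_{j ≤ r} p_j / log p_j > ((r+3)/c₇)^{r+3}` for the first `r` primes; this is the form used.
[cite: StewartYu1991, Lemma 4] -/
theorem card_pow_card_mul_prod_log_le {S : Finset ℕ} (hS : ∀ q ∈ S, q.Prime) :
    (S.card : ℝ) ^ S.card * ∏ q ∈ S, Real.log ((max 4 q : ℕ) : ℝ) ≤
      15 ^ S.card * ∏ q ∈ S, (q : ℝ) := by
  induction S using Finset.induction_on_max with
  | empty => simp
  | insert a s hlt ih =>
    have ha : a ∉ s := fun h => lt_irrefl a (hlt a h)
    have hs : ∀ q ∈ s, q.Prime := fun q hq => hS q (Finset.mem_insert_of_mem hq)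
    have hap : a.Prime := hS a (Finset.mem_insert_self a s)
    have ih' := ih hs
    rw [Finset.card_insert_of_notMem ha, Finset.prod_insert ha, Finset.prod_insert ha]
    set m := s.card with hm
    set PL := ∏ q ∈ s, Real.log ((max 4 q : ℕ) : ℝ) with hPL
    set G := ∏ q ∈ s, (q : ℝ) with hG
    have hPL0 : 0 ≤ PL := Finset.prod_nonneg fun q _ => Real.log_nonneg (by
      exact_mod_cast (le_max_left 4 q).trans' (by norm_num))
    have hG0 : 0 ≤ G := Finset.prod_nonneg fun q _ => Nat.cast_nonneg _
    have hlogA0 : 0 < Real.log ((max 4 a : ℕ) : ℝ) := Real.log_pos (by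
      exact_mod_cast lt_of_lt_of_le (by norm_num) (le_max_left 4 a))
    -- Chebyshev: `m + 1 ≤ 5 a / log max(4,a)`
    have hcheb : ((m + 1 : ℕ) : ℝ) ≤ 5 * a / Real.log ((max 4 a : ℕ) : ℝ) := by
      have h := card_le_of_forall_le_prime hS hap (fun q hq => by
        rcases Finset.mem_insert.mp hq with rfl | hq
        · exact le_rfl
        · exact (hlt q hq).le)
      rwa [Finset.card_insert_of_notMem ha] at h
    have hcheb' : ((m : ℝ) + 1) * Real.log ((max 4 a : ℕ) : ℝ) ≤ 5 * a := by
      rw [le_div_iff₀ hlogA0, Nat.cast_add_one] at hcheb; exact hcheb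
    -- `(m+1)^{m+1} = (m+1) (m+1)^m ≤ (m+1) e m^m`
    have hpow : ((m + 1 : ℕ) : ℝ) ^ (m + 1) ≤ ((m : ℝ) + 1) * (Real.exp 1 * (m : ℝ) ^ m) := by
      push_cast
      rw [pow_succ, mul_comm]
      exact mul_le_mul_of_nonneg_left (succ_pow_le_exp_mul_pow m) (by positivity)
    have he3 : Real.exp 1 ≤ 3 := by
      have := Real.exp_one_lt_d9; linarith
    calc ((m + 1 : ℕ) : ℝ) ^ (m + 1) * (Real.log ((max 4 a : ℕ) : ℝ) * PL)
        ≤ ((m : ℝ) + 1) * (Real.exp 1 * (m : ℝ) ^ m) * (Real.log ((max 4 a : ℕ) : ℝ) * PL) :=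
          mul_le_mul_of_nonneg_right hpow (mul_nonneg hlogA0.le hPL0)
      _ = Real.exp 1 * (((m : ℝ) + 1) * Real.log ((max 4 a : ℕ) : ℝ)) * ((m : ℝ) ^ m * PL) := by
          ring
      _ ≤ 3 * (5 * a) * (15 ^ m * G) := by
          apply mul_le_mul (mul_le_mul he3 hcheb' (by positivity) (by norm_num)) ih'
            (by positivity) (by positivity)
      _ = 15 ^ (m + 1) * (a * G) := by ring

/-- **Absorption of `k^k` for `k ≤ #S + 3`:** for a finite set `S` of primes and `k ≤ #S + 3`,
`k^k · ∏_{q ∈ S} log max(4, q) ≤ 600^{#S+1} · ∏_{q ∈ S} q` — Lemma 4 applied to all primes of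
`xyz` but the three largest ones `p_x, p_y, p_z`. [cite: StewartYu1991, Lemma 4 and (17)–(18)] -/
theorem pow_self_mul_prod_log_le {S : Finset ℕ} (hS : ∀ q ∈ S, q.Prime) {k : ℕ}
    (hk : k ≤ S.card + 3) :
    (k : ℝ) ^ k * ∏ q ∈ S, Real.log ((max 4 q : ℕ) : ℝ) ≤
      600 ^ (S.card + 1) * ∏ q ∈ S, (q : ℝ) := by
  set m := S.card with hm
  set PL := ∏ q ∈ S, Real.log ((max 4 q : ℕ) : ℝ) with hPL
  have hPL0 : 0 ≤ PL := Finset.prod_nonneg fun q _ => Real.log_nonneg (by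
    exact_mod_cast (le_max_left 4 q).trans' (by norm_num))
  -- `k^k ≤ (m+3)^{m+3}`
  have hkk : (k : ℝ) ^ k ≤ ((m : ℝ) + 3) ^ (m + 3) := by
    have h1 : k ^ k ≤ (m + 3) ^ (m + 3) :=
      (Nat.pow_le_pow_left hk k).trans (Nat.pow_le_pow_right (by omega) hk)
    exact_mod_cast h1
  -- `(m+3)^{m+3} = (m+3)^3 (m+3)^m ≤ 27 · 8^m · e^3 · m^m`
  have h3 : ((m : ℝ) + 3) ≤ 3 * 2 ^ m := by
    have : (m : ℝ) + 1 ≤ 2 ^ m := by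
      have h := Nat.lt_two_pow_self (n := m)
      exact_mod_cast h
    nlinarith [show (1 : ℝ) ≤ 2 ^ m from one_le_pow₀ (by norm_num)]
  have hcube : ((m : ℝ) + 3) ^ 3 ≤ 27 * 8 ^ m := by
    calc ((m : ℝ) + 3) ^ 3 ≤ (3 * 2 ^ m) ^ 3 := pow_le_pow_left₀ (by positivity) h3 3
      _ = 27 * 8 ^ m := by rw [mul_pow, ← pow_mul, mul_comm m 3, pow_mul]; norm_num
  have he3 : Real.exp 3 ≤ 21 := by
    have h := Real.exp_one_lt_d9
    have h0 := Real.exp_pos 1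
    have : Real.exp 3 = Real.exp 1 ^ 3 := by rw [← Real.exp_nat_mul]; norm_num
    rw [this]
    have h1 : Real.exp 1 ^ 3 ≤ (2.7182818286 : ℝ) ^ 3 := pow_le_pow_left₀ h0.le h.le 3
    have h2 : (2.7182818286 : ℝ) ^ 3 ≤ 21 := by norm_num
    linarith
  have hmain := card_pow_card_mul_prod_log_le hS
  rw [← hm, ← hPL] at hmain
  calc (k : ℝ) ^ k * PL ≤ ((m : ℝ) + 3) ^ (m + 3) * PL := mul_le_mul_of_nonneg_right hkk hPL0
    _ = ((m : ℝ) + 3) ^ 3 * ((m : ℝ) + 3) ^ m * PL := by ring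
    _ ≤ (27 * 8 ^ m) * (Real.exp 3 * (m : ℝ) ^ m) * PL := by
        apply mul_le_mul_of_nonneg_right _ hPL0
        exact mul_le_mul hcube (add_three_pow_le_exp_mul_pow m) (by positivity) (by positivity)
    _ = 27 * Real.exp 3 * 8 ^ m * ((m : ℝ) ^ m * PL) := by ring
    _ ≤ 27 * 21 * 8 ^ m * (15 ^ m * ∏ q ∈ S, (q : ℝ)) := by
        apply mul_le_mul _ hmain (by positivity) (by positivity)
        gcongr
    _ = 567 * 120 ^ m * ∏ q ∈ S, (q : ℝ) := by
        rw [show (120 : ℝ) = 8 * 15 by norm_num, mul_pow]; ring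
    _ ≤ 600 * 600 ^ m * ∏ q ∈ S, (q : ℝ) := by
        have hq0 : 0 ≤ ∏ q ∈ S, (q : ℝ) := Finset.prod_nonneg fun q _ => Nat.cast_nonneg _
        apply mul_le_mul_of_nonneg_right _ hq0
        apply mul_le_mul (by norm_num) (pow_le_pow_left₀ (by norm_num) (by norm_num) m)
          (by positivity) (by norm_num)
    _ = 600 ^ (m + 1) * ∏ q ∈ S, (q : ℝ) := by ring

/-- **`D^r` is `G^{o(1)}`:** if `r^r ≤ c^{r+1} G` (the number `r` of primes of `G` against
Lemma 4), then for every `ε > 0`, `D^r ≤ A(D, c, ε) · G^ε` ("again by Lemma 4 we see that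
`c₁₆^r < G^{c₁₇/log log G}`"). [cite: StewartYu1991, (18) and p. 230] -/
theorem exists_pow_le_mul_rpow {D c ε : ℝ} (hD : 1 ≤ D) (hc : 1 ≤ c) (hε : 0 < ε) :
    ∃ A : ℝ, 1 ≤ A ∧ ∀ (r : ℕ) (G : ℝ), 1 ≤ G → (r : ℝ) ^ r ≤ c ^ (r + 1) * G →
      D ^ r ≤ A * G ^ ε := by
  set θ : ℝ := c * D ^ (1 / ε) with hθ
  have hD0 : 0 < D := by linarith
  have hc0 : 0 < c := by linarith
  have hDε : 1 ≤ D ^ (1 / ε) := Real.one_le_rpow hD (by positivity)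
  have hθ1 : c ≤ θ := by rw [hθ]; nlinarith
  refine ⟨D ^ θ * c ^ ε, ?_, ?_⟩
  · exact one_le_mul_of_one_le_of_one_le (Real.one_le_rpow hD (by nlinarith))
      (Real.one_le_rpow hc hε.le)
  intro r G hG hr
  have hGε : 1 ≤ G ^ ε := Real.one_le_rpow hG hε.le
  have hcε : 1 ≤ c ^ ε := Real.one_le_rpow hc hε.le
  have hDθ : 1 ≤ D ^ θ := Real.one_le_rpow hD (by nlinarith)
  by_cases hrθ : (r : ℝ) ≤ θ
  · -- few primes: `D^r ≤ D^θ`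
    have h1 : D ^ r ≤ D ^ θ := by
      rw [← Real.rpow_natCast]
      exact Real.rpow_le_rpow_of_exponent_le hD hrθ
    calc D ^ r ≤ D ^ θ := h1
      _ ≤ D ^ θ * c ^ ε * G ^ ε := by nlinarith [mul_nonneg (by linarith : (0:ℝ) ≤ D ^ θ) (by linarith : (0:ℝ) ≤ c ^ ε)]
  · push Not at hrθ
    have hr0 : (0 : ℝ) < r := by linarith
    have hrc : D ^ (1 / ε) < r / c := by
      rw [lt_div_iff₀ hc0]; rw [hθ] at hrθ; linarith
    -- from `r^r ≤ c^{r+1} G`: `r log(r/c) ≤ log(c G)`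
    have hlog1 : (r : ℝ) * Real.log (r / c) ≤ Real.log (c * G) := by
      have h1 : Real.log ((r : ℝ) ^ r) ≤ Real.log (c ^ (r + 1) * G) :=
        Real.log_le_log (by positivity) hr
      rw [Real.log_pow, Real.log_mul (by positivity) (by linarith), Real.log_pow] at h1
      rw [Real.log_div hr0.ne' hc0.ne', Real.log_mul hc0.ne' (by linarith)]
      push_cast at h1
      nlinarith
    -- `log(r/c) > (1/ε) log D ≥ 0`
    have hlog2 : (1 / ε) * Real.log D < Real.log (r / c) := by
      rw [← Real.log_rpow hD0]
      exact Real.log_lt_log (by positivity) hrc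
    have hlogD : 0 ≤ Real.log D := Real.log_nonneg hD
    have h3 : (r : ℝ) * ((1 / ε) * Real.log D) ≤ Real.log (c * G) := by
      calc (r : ℝ) * ((1 / ε) * Real.log D) ≤ (r : ℝ) * Real.log (r / c) :=
            mul_le_mul_of_nonneg_left hlog2.le hr0.le
        _ ≤ Real.log (c * G) := hlog1
    have h4 : (r : ℝ) * Real.log D ≤ ε * Real.log (c * G) := by
      have := mul_le_mul_of_nonneg_left h3 hε.le
      calc (r : ℝ) * Real.log D = ε * ((r : ℝ) * ((1 / ε) * Real.log D)) := by field_simp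
        _ ≤ ε * Real.log (c * G) := this
    have h5 : D ^ r ≤ (c * G) ^ ε := by
      rw [← Real.rpow_natCast, Real.rpow_def_of_pos hD0, Real.rpow_def_of_pos (by positivity)]
      apply Real.exp_le_exp.mpr
      rw [mul_comm (Real.log D)]
      linarith [mul_comm (Real.log (c * G)) ε]
    calc D ^ r ≤ (c * G) ^ ε := h5
      _ = c ^ ε * G ^ ε := Real.mul_rpow hc0.le (by linarith)
      _ ≤ D ^ θ * c ^ ε * G ^ ε := by
          apply mul_le_mul_of_nonneg_right _ (by linarith)
          nlinarith

end LemmaFour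

/-! ### Lemma 2 of the paper for a sorted set of primes (Waldschmidt 1980, Prop. 3.8, via Lemma 3) -/

section ArchSorted

variable (Cw : ℕ → ℝ)

/-- **Lemma 2 + Lemma 3 of Stewart–Yu for `Λ = ∑_{p ∈ L} e_p log p`** (`L` a non-empty set of
primes, `|e_p| ≤ B`, `B ≥ 1`, `log max(4, p) ≤ Λ₁` on `L`): from the `E = 2` form `hW₂` of
Waldschmidt's Proposition 3.8 over `ℚ` with `q = 2` (the binder of
`BakerMethodBoundsKummerArchProofs`, any constant function `Cw ≥ 0`), applied to the generators
`p ∈ L` in INCREASING order with `V_p = log max(4, p)` (so that `V` is monotone and the product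
of the `V`'s is `∏_{p ∈ L} log max(4, p)`, not a power of `log max L`), `W = log(eB)`; the Kummer
condition `[ℚ(√p : p ∈ L) : ℚ] = 2^{#L}` is Lemma 3 of the paper
(`finrank_adjoin_sqrt_eq_two_pow`, `not_isSquare_prod_snoc`):
`log |Λ| > −Cw(#L) · ∏_{p ∈ L} log max(4,p) · (log(eB) + log(2Λ₁)) · log(2Λ₁) / (log 2)^{#L+1}`.
[cite: StewartYu1991, Lemma 2, Lemma 3] [cite: Waldschmidt1980, Prop 3.8 (p. 274)] -/
theorem arch_lower_bound_primes_sorted (hCw : ∀ n, 0 ≤ Cw n)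
    (hW₂ : ∀ (n : ℕ) (α : Fin (n + 1) → ℚ) (b : Fin (n + 1) → ℤ) (V : Fin (n + 1) → ℝ) (W : ℝ),
      (∀ j, 0 < α j ∧ α j ≠ 1) →
      Module.finrank ℚ ↥(IntermediateField.adjoin ℚ
          (Set.range fun j => Real.sqrt (α j : ℝ))) = 2 ^ (n + 1) →
      Monotone V → 1 ≤ V 0 →
      (∀ j, max (logHeight₁ (α j)) |Real.log (α j : ℝ)| ≤ V j) →
      0 < W → (∀ j, logHeight₁ (b j : ℚ) ≤ W) →
      ∑ j, (b j : ℝ) * Real.log (α j : ℝ) ≠ 0 →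
      Real.exp (-(Cw (n + 1) * (∏ j, V j) * (W + Real.log (2 * V (Fin.last n))) *
          Real.log (2 * (if n = 0 then 1 else V ⟨n - 1, by omega⟩)) / Real.log 2 ^ (n + 2))) <
        |∑ j, (b j : ℝ) * Real.log (α j : ℝ)|)
    (L : Finset ℕ) (hL : ∀ p ∈ L, p.Prime) (hLne : L.Nonempty) (e : ℕ → ℤ)
    {Λ₁ : ℝ} (hΛ₁ : 1 ≤ Λ₁) (hΛL : ∀ p ∈ L, Real.log ((max 4 p : ℕ) : ℝ) ≤ Λ₁)
    {B : ℝ} (hB1 : 1 ≤ B) (hBe : ∀ p ∈ L, (|e p| : ℝ) ≤ B)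
    (hΛ : ∑ p ∈ L, (e p : ℝ) * Real.log p ≠ 0) :
    -(Cw L.card * (∏ p ∈ L, Real.log ((max 4 p : ℕ) : ℝ)) *
        (Real.log (Real.exp 1 * B) + Real.log (2 * Λ₁)) * Real.log (2 * Λ₁) /
        Real.log 2 ^ (L.card + 1)) <
      Real.log |∑ p ∈ L, (e p : ℝ) * Real.log p| := by
  classical
  -- the largest prime `P` of `L` is the last generator, the others in increasing order
  set P : ℕ := L.max' hLne with hPdef
  have hPL : P ∈ L := Finset.max'_mem L hLne
  have hPp : P.Prime := hL P hPL
  set L' : Finset ℕ := L.erase P with hL'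
  have hL'sub : L' ⊆ L := Finset.erase_subset _ _
  set k : ℕ := L'.card with hk
  have hcard : k + 1 = L.card := by rw [hk, hL', Finset.card_erase_of_mem hPL]; exact Nat.sub_add_cancel (Finset.card_pos.mpr hLne)
  set pr : Fin k → ℕ := fun i => L'.orderEmbOfFin hk.symm i with hpr
  have hprL' : ∀ i, pr i ∈ L' := fun i => L'.orderEmbOfFin_mem hk.symm i
  have hprL : ∀ i, pr i ∈ L := fun i => hL'sub (hprL' i)
  have hprp : ∀ i, (pr i).Prime := fun i => hL _ (hprL i)
  have hinj : Function.Injective pr := (L'.orderEmbOfFin hk.symm).injective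
  have hprmono : Monotone pr := (L'.orderEmbOfFin hk.symm).monotone
  have hprlt : ∀ i, pr i < P := fun i =>
    lt_of_le_of_ne (L.le_max' _ (hprL i)) (Finset.ne_of_mem_erase (hprL' i))
  have hprne : ∀ i, pr i ≠ P := fun i => (hprlt i).ne
  -- generators, exponents, `V`, `W`
  set αN : Fin (k + 1) → ℕ := Fin.snoc pr P with hαN
  set α : Fin (k + 1) → ℚ := fun j => (αN j : ℚ) with hα
  set b : Fin (k + 1) → ℤ := fun j => e (αN j) with hb
  set V : Fin (k + 1) → ℝ := fun j => Real.log ((max 4 (αN j) : ℕ) : ℝ) with hV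
  set W : ℝ := Real.log (Real.exp 1 * B) with hWdef
  have hαNL : ∀ j, αN j ∈ L := by
    intro j
    rcases Fin.eq_castSucc_or_eq_last j with ⟨i, rfl⟩ | rfl
    · simp only [hαN, Fin.snoc_castSucc]; exact hprL i
    · simp only [hαN, Fin.snoc_last]; exact hPL
  have hαNp : ∀ j, (αN j).Prime := fun j => hL _ (hαNL j)
  have hαNmono : Monotone αN := by
    intro i j hij
    rcases Fin.eq_castSucc_or_eq_last j with ⟨j', rfl⟩ | rfl
    · rcases Fin.eq_castSucc_or_eq_last i with ⟨i', rfl⟩ | rfl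
      · simp only [hαN, Fin.snoc_castSucc]
        exact hprmono (Fin.castSucc_le_castSucc_iff.mp hij)
      · exact absurd hij (not_le.mpr (Fin.castSucc_lt_last j'))
    · rcases Fin.eq_castSucc_or_eq_last i with ⟨i', rfl⟩ | rfl
      · simp only [hαN, Fin.snoc_castSucc, Fin.snoc_last]; exact (hprlt i').le
      · exact le_rfl
  have he2 : (2 : ℝ) ≤ Real.exp 1 := by have := Real.add_one_le_exp (1 : ℝ); linarith
  -- hypotheses of `hW₂`
  have hαpos : ∀ j, 0 < α j ∧ α j ≠ 1 := fun j =>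
    ⟨by simp only [hα]; exact_mod_cast (hαNp j).pos,
     by simp only [hα]; exact_mod_cast (hαNp j).one_lt.ne'⟩
  have hαsnoc : α = Fin.snoc (fun i => (pr i : ℚ)) (P : ℚ) := by
    funext j
    rcases Fin.eq_castSucc_or_eq_last j with ⟨i, rfl⟩ | rfl
    · simp only [hα, hαN, Fin.snoc_castSucc]
    · simp only [hα, hαN, Fin.snoc_last]
  have hKum : Module.finrank ℚ ↥(IntermediateField.adjoin ℚ
      (Set.range fun j => Real.sqrt (α j : ℝ))) = 2 ^ (k + 1) := by
    have hν : ∀ i, padicValRat (pr i) (P : ℚ) = 0 := by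
      intro i
      haveI : Fact (pr i).Prime := ⟨hprp i⟩
      haveI : Fact P.Prime := ⟨hPp⟩
      rw [padicValRat.of_nat, padicValNat_primes (hprne i), Nat.cast_zero]
    have hind := not_isSquare_prod_snoc pr hprp hinj
      (show (P : ℚ) ≠ 0 by exact_mod_cast hPp.ne_zero) (not_isSquare_ratCast_prime hPp) hν
    rw [hαsnoc]
    exact finrank_adjoin_sqrt_eq_two_pow _
      (fun j => by rw [← hαsnoc]; exact (hαpos j).1.le) hind
  have hmono : Monotone V := by
    intro i j hij
    simp only [hV]
    apply Real.log_le_log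
    · exact_mod_cast lt_of_lt_of_le (by norm_num) (le_max_left 4 (αN i))
    · exact_mod_cast max_le_max le_rfl (hαNmono hij)
  have hV1 : ∀ j, 1 ≤ V j := by
    intro j
    simp only [hV]
    have h4 : (4 : ℝ) ≤ ((max 4 (αN j) : ℕ) : ℝ) := by exact_mod_cast le_max_left 4 (αN j)
    have hlog4 : (1 : ℝ) ≤ Real.log 4 := by
      rw [← Real.log_exp 1]
      apply Real.log_le_log (Real.exp_pos 1)
      have := Real.exp_one_lt_d9; linarith
    exact hlog4.trans (Real.log_le_log (by norm_num) h4)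
  have hV0 : 1 ≤ V 0 := hV1 0
  have hVj : ∀ j, max (logHeight₁ (α j)) |Real.log (α j : ℝ)| ≤ V j := by
    intro j
    simp only [hα, hV]
    have hp := hαNp j
    haveI : NeZero (αN j) := ⟨hp.ne_zero⟩
    have hlog0 : 0 ≤ Real.log (αN j : ℝ) := Real.log_nonneg (by exact_mod_cast hp.one_lt.le)
    rw [Rat.logHeight₁_natCast, Rat.cast_natCast, abs_of_nonneg hlog0, max_self]
    apply Real.log_le_log (by exact_mod_cast hp.pos)
    exact_mod_cast le_max_right 4 (αN j)
  have hW1 : 1 ≤ W := by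
    rw [hWdef, Real.log_mul (Real.exp_pos 1).ne' (by linarith), Real.log_exp]
    linarith [Real.log_nonneg hB1]
  have hW0 : 0 < W := by linarith
  have hWb : ∀ j, logHeight₁ (b j : ℚ) ≤ W := by
    intro j
    have hbj : (|(b j : ℝ)|) ≤ B := by simp only [hb]; exact hBe _ (hαNL j)
    rw [logHeight₁_intCast_eq, hWdef]
    apply Real.log_le_log (by positivity)
    calc max (|(b j : ℝ)|) 1 ≤ B := max_le hbj hB1
      _ = 1 * B := (one_mul B).symm
      _ ≤ Real.exp 1 * B := by gcongr; linarith
  -- reindexing the sum and the product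
  have himg : Finset.image pr Finset.univ = L' := by
    rw [hpr]; exact Finset.image_orderEmbOfFin_univ L' hk.symm
  have hsum : ∑ j, (b j : ℝ) * Real.log (α j : ℝ) = ∑ p ∈ L, (e p : ℝ) * Real.log p := by
    rw [Fin.sum_univ_castSucc]
    simp only [hα, hb, hαN, Fin.snoc_castSucc, Fin.snoc_last, Rat.cast_natCast]
    rw [← Finset.add_sum_erase L _ hPL, add_comm]
    congr 1
    rw [← Finset.sum_image (f := fun p : ℕ => (e p : ℝ) * Real.log p)
      (fun i _ j _ h => hinj h), himg]
  have hprodV : ∏ j, V j = ∏ p ∈ L, Real.log ((max 4 p : ℕ) : ℝ) := by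
    rw [Fin.prod_univ_castSucc]
    simp only [hV, hαN, Fin.snoc_castSucc, Fin.snoc_last]
    rw [← Finset.mul_prod_erase L _ hPL, mul_comm]
    congr 1
    rw [← Finset.prod_image (f := fun p : ℕ => Real.log ((max 4 p : ℕ) : ℝ))
      (fun i _ j _ h => hinj h), himg]
  -- apply the hypothesis
  have key := hW₂ k α b V W hαpos hKum hmono hV0 hVj hW0 hWb (by rw [hsum]; exact hΛ)
  rw [hsum, hprodV] at key
  have hlast : V (Fin.last k) ≤ Λ₁ := by
    simp only [hV, hαN, Fin.snoc_last]; exact hΛL P hPL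
  have hVΛ : ∀ j, V j ≤ Λ₁ := fun j => (hmono (Fin.le_last j)).trans hlast
  have hsecond : (if k = 0 then (1 : ℝ) else V ⟨k - 1, by omega⟩) ≤ Λ₁ := by
    split_ifs with h0
    · exact hΛ₁
    · exact hVΛ _
  have hsecond1 : 1 ≤ (if k = 0 then (1 : ℝ) else V ⟨k - 1, by omega⟩) := by
    split_ifs with h0
    · exact le_rfl
    · exact hV1 _
  -- monotonicity of the exponent
  set PL := ∏ p ∈ L, Real.log ((max 4 p : ℕ) : ℝ) with hPL
  have hPL0 : 0 ≤ PL := Finset.prod_nonneg fun q _ => Real.log_nonneg (by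
    exact_mod_cast (le_max_left 4 q).trans' (by norm_num))
  have hlog2 : 0 < Real.log 2 := Real.log_pos one_lt_two
  have hWH : 0 ≤ W + Real.log (2 * V (Fin.last k)) := by
    have : 0 ≤ Real.log (2 * V (Fin.last k)) := Real.log_nonneg (by linarith [hV1 (Fin.last k)])
    linarith
  have hfac1 : W + Real.log (2 * V (Fin.last k)) ≤ W + Real.log (2 * Λ₁) := by
    have := Real.log_le_log (by linarith [hV1 (Fin.last k)]) (by linarith [hlast] : 2 * V (Fin.last k) ≤ 2 * Λ₁)
    linarith
  have hfac2 : Real.log (2 * (if k = 0 then (1 : ℝ) else V ⟨k - 1, by omega⟩)) ≤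
      Real.log (2 * Λ₁) := Real.log_le_log (by linarith) (by linarith)
  have hfac20 : 0 ≤ Real.log (2 * (if k = 0 then (1 : ℝ) else V ⟨k - 1, by omega⟩)) :=
    Real.log_nonneg (by linarith)
  have hUle : Cw (k + 1) * PL * (W + Real.log (2 * V (Fin.last k))) *
        Real.log (2 * (if k = 0 then (1 : ℝ) else V ⟨k - 1, by omega⟩)) / Real.log 2 ^ (k + 2) ≤
      Cw (k + 1) * PL * (W + Real.log (2 * Λ₁)) * Real.log (2 * Λ₁) / Real.log 2 ^ (k + 2) := by
    apply div_le_div_of_nonneg_right _ (by positivity)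
    apply mul_le_mul _ hfac2 hfac20
      (mul_nonneg (mul_nonneg (hCw _) hPL0) (hWH.trans hfac1))
    exact mul_le_mul_of_nonneg_left hfac1 (mul_nonneg (hCw _) hPL0)
  have hpos : 0 < |∑ p ∈ L, (e p : ℝ) * Real.log p| := abs_pos.mpr hΛ
  rw [Real.lt_log_iff_exp_lt hpos, ← hcard]
  exact lt_of_le_of_lt (Real.exp_le_exp.mpr (neg_le_neg hUle)) key

end ArchSorted

/-! ### The largest prime factor and the absorption of `(p_x p_y p_z)²` -/

section LargestPrime

/-- `1 ≤ P(n)`. [folklore] -/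
theorem one_le_largestPrimeFactor (n : ℕ) : 1 ≤ largestPrimeFactor n := by
  rw [largestPrimeFactor_def]; exact le_max_left _ _

/-- For `n` with a prime factor, `P(n)` is a prime factor of `n`. [folklore] -/
theorem largestPrimeFactor_mem {n : ℕ} (hn : n.primeFactors.Nonempty) :
    largestPrimeFactor n ∈ n.primeFactors := by
  classical
  rw [largestPrimeFactor_def]
  obtain ⟨q, hq, hsup⟩ := Finset.exists_mem_eq_sup n.primeFactors hn id
  have h2 : 2 ≤ n.primeFactors.sup id := by
    rw [hsup]; exact (Nat.prime_of_mem_primeFactors hq).two_le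
  rw [max_eq_right (by omega), hsup]
  exact hq

/-- The "top prime" of `n` as a subset of its prime factors: `{P(n)} ∩ primeFactors(n)` has at
most one element … [folklore] -/
theorem card_filter_eq_largestPrimeFactor_le (n : ℕ) :
    (n.primeFactors.filter (fun q => q = largestPrimeFactor n)).card ≤ 1 := by
  apply Finset.card_le_one.mpr
  intro x hx y hy
  rw [Finset.mem_filter] at hx hy
  rw [hx.2, hy.2]

/-- … and its product is `P(n)` (also for `n = 1`, where both sides are `1`). [folklore] -/
theorem prod_filter_eq_largestPrimeFactor (n : ℕ) :
    ∏ q ∈ n.primeFactors.filter (fun q => q = largestPrimeFactor n), (q : ℝ) =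
      largestPrimeFactor n := by
  classical
  rcases n.primeFactors.eq_empty_or_nonempty with h0 | hne
  · have h1 : largestPrimeFactor n = 1 := by
      rw [largestPrimeFactor_def, h0, Finset.sup_empty, Nat.bot_eq_zero, max_eq_left zero_le_one]
    rw [h1, h0, Finset.filter_empty, Finset.prod_empty, Nat.cast_one]
  · have hmem := largestPrimeFactor_mem hne
    have hfilt : n.primeFactors.filter (fun q => q = largestPrimeFactor n) =
        {largestPrimeFactor n} := by
      ext q
      simp only [Finset.mem_filter, Finset.mem_singleton]
      exact ⟨fun h => h.2, fun h => ⟨h ▸ hmem, h⟩⟩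
    rw [hfilt, Finset.prod_singleton]

/-- **Absorption of `r^r`, of the top primes and of the small log-factors** (Lemma 4 applied to
the primes of `xyz` other than `p_x, p_y, p_z`): for a set `S` of primes, a subset `T ⊆ S` with at
most three elements, and `Λ ≥ 1` with `log max(4,q) ≤ Λ` on `S`:
`#S^{#S} · ∏_{q ∈ T} q · ∏_{q ∈ S} log max(4,q) ≤ 600^{#S+1} · ∏_{q ∈ S} q · Λ³`.
[cite: StewartYu1991, (17)–(18)] -/
theorem pow_card_mul_prod_top_mul_prod_log_le {S T : Finset ℕ} (hS : ∀ q ∈ S, q.Prime)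
    (hTS : T ⊆ S) (hT3 : T.card ≤ 3) {Λ : ℝ} (hΛ1 : 1 ≤ Λ)
    (hΛS : ∀ q ∈ S, Real.log ((max 4 q : ℕ) : ℝ) ≤ Λ) :
    (S.card : ℝ) ^ S.card * (∏ q ∈ T, (q : ℝ)) * ∏ q ∈ S, Real.log ((max 4 q : ℕ) : ℝ) ≤
      600 ^ (S.card + 1) * (∏ q ∈ S, (q : ℝ)) * Λ ^ 3 := by
  classical
  set U : Finset ℕ := S \ T with hU
  have hdisj : Disjoint T U := Finset.disjoint_sdiff
  have hSTU : S = T ∪ U := by rw [hU, Finset.union_sdiff_of_subset hTS]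
  have hUS : ∀ q ∈ U, q.Prime := fun q hq => hS q (Finset.sdiff_subset hq)
  have hcardS : S.card = T.card + U.card := by
    rw [hSTU, Finset.card_union_of_disjoint hdisj]
  have hk : S.card ≤ U.card + 3 := by omega
  have hlog0 : ∀ q : ℕ, 0 ≤ Real.log ((max 4 q : ℕ) : ℝ) := fun q =>
    Real.log_nonneg (by exact_mod_cast (le_max_left 4 q).trans' (by norm_num))
  have hprodlog : ∏ q ∈ S, Real.log ((max 4 q : ℕ) : ℝ) =
      (∏ q ∈ T, Real.log ((max 4 q : ℕ) : ℝ)) * ∏ q ∈ U, Real.log ((max 4 q : ℕ) : ℝ) := by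
    rw [hSTU, Finset.prod_union hdisj]
  have hprodq : ∏ q ∈ S, (q : ℝ) = (∏ q ∈ T, (q : ℝ)) * ∏ q ∈ U, (q : ℝ) := by
    rw [hSTU, Finset.prod_union hdisj]
  -- the small log-factors of `T`
  have hTlog : ∏ q ∈ T, Real.log ((max 4 q : ℕ) : ℝ) ≤ Λ ^ 3 := by
    calc ∏ q ∈ T, Real.log ((max 4 q : ℕ) : ℝ) ≤ ∏ _q ∈ T, Λ :=
          Finset.prod_le_prod (fun q _ => hlog0 q) (fun q hq => hΛS q (hTS hq))
      _ = Λ ^ T.card := Finset.prod_const Λ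
      _ ≤ Λ ^ 3 := pow_le_pow_right₀ hΛ1 hT3
  -- Lemma 4 on `U`
  have hU4 := pow_self_mul_prod_log_le hUS hk
  have hT0 : 0 ≤ ∏ q ∈ T, (q : ℝ) := Finset.prod_nonneg fun q _ => Nat.cast_nonneg _
  have hU0 : 0 ≤ ∏ q ∈ U, (q : ℝ) := Finset.prod_nonneg fun q _ => Nat.cast_nonneg _
  have hTl0 : 0 ≤ ∏ q ∈ T, Real.log ((max 4 q : ℕ) : ℝ) := Finset.prod_nonneg fun q _ => hlog0 q
  have hUl0 : 0 ≤ ∏ q ∈ U, Real.log ((max 4 q : ℕ) : ℝ) := Finset.prod_nonneg fun q _ => hlog0 q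
  have h600 : (600 : ℝ) ^ (U.card + 1) ≤ 600 ^ (S.card + 1) :=
    pow_le_pow_right₀ (by norm_num) (by omega)
  rw [hprodlog, hprodq]
  calc (S.card : ℝ) ^ S.card * (∏ q ∈ T, (q : ℝ)) *
        ((∏ q ∈ T, Real.log ((max 4 q : ℕ) : ℝ)) * ∏ q ∈ U, Real.log ((max 4 q : ℕ) : ℝ))
      = (∏ q ∈ T, (q : ℝ)) * (∏ q ∈ T, Real.log ((max 4 q : ℕ) : ℝ)) *
          ((S.card : ℝ) ^ S.card * ∏ q ∈ U, Real.log ((max 4 q : ℕ) : ℝ)) := by ring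
    _ ≤ (∏ q ∈ T, (q : ℝ)) * Λ ^ 3 * (600 ^ (U.card + 1) * ∏ q ∈ U, (q : ℝ)) := by
        exact mul_le_mul (mul_le_mul_of_nonneg_left hTlog hT0) hU4
          (mul_nonneg (pow_nonneg (Nat.cast_nonneg _) _) hUl0)
          (mul_nonneg hT0 (pow_nonneg (zero_le_one.trans hΛ1) 3))
    _ ≤ (∏ q ∈ T, (q : ℝ)) * Λ ^ 3 * (600 ^ (S.card + 1) * ∏ q ∈ U, (q : ℝ)) := by
        exact mul_le_mul_of_nonneg_left (mul_le_mul_of_nonneg_right h600 hU0)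
          (mul_nonneg hT0 (pow_nonneg (zero_le_one.trans hΛ1) 3))
    _ = 600 ^ (S.card + 1) * ((∏ q ∈ T, (q : ℝ)) * ∏ q ∈ U, (q : ℝ)) * Λ ^ 3 := by ring

end LargestPrime

/-! ### §3 of the paper: the max-ord device (9) and the three congruences (10)–(12) -/

section Routes

variable {a b c : ℕ}

/-- **(9): `log w ≤ (max_{p ∣ w} ord_p w) · log rad(w)`** — if every exponent in `w` is at most
`M` then `log w ≤ M · log ∏_{p ∣ w} p`. [cite: StewartYu1991, (9)] -/
theorem log_le_mul_log_prod_primeFactors {w : ℕ} (hw : w ≠ 0) {M : ℝ}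
    (h : ∀ p ∈ w.primeFactors, (w.factorization p : ℝ) ≤ M) :
    Real.log w ≤ M * Real.log (∏ p ∈ w.primeFactors, (p : ℝ)) := by
  rw [log_eq_sum_factorization_mul_log hw, Real.log_prod]
  · rw [Finset.mul_sum]
    apply Finset.sum_le_sum
    intro p hp
    have hlogp : 0 ≤ Real.log (p : ℝ) :=
      Real.log_nonneg (by exact_mod_cast (Nat.prime_of_mem_primeFactors hp).one_lt.le)
    exact mul_le_mul_of_nonneg_right (h p hp) hlogp
  · intro p hp
    exact_mod_cast (Nat.prime_of_mem_primeFactors hp).ne_zero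

/-- **(11): the congruence at a prime of `y`.** For `p ∣ b`:
`ord_p((z/x) − 1) = ord_p(y/x) = ord_p y`, with `z/x = ∏_{q ∣ xz} q^{e_q}`.
[cite: StewartYu1991, (11)] -/
theorem padicValRat_route_b (h : IsABCTriple a b c) {p : ℕ} (hp : p ∈ b.primeFactors) :
    padicValRat p (∏ q ∈ (c * a).primeFactors, (q : ℚ) ^ expDiff c a q - 1) =
      b.factorization p := by
  obtain ⟨ha, hb, habc, hcop⟩ := id h
  have hc : c ≠ 0 := by omega
  have hpp : p.Prime := Nat.prime_of_mem_primeFactors hp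
  haveI : Fact p.Prime := ⟨hpp⟩
  have hca : c.Coprime a := (coprime_left_of_isABCTriple h).symm
  rw [← cast_div_eq_prod_zpow hc ha.ne' hca]
  have hq : (c : ℚ) / a - 1 = (b : ℚ) / a := by
    rw [← habc]; push_cast; field_simp; ring
  rw [hq, padicValRat.div (by exact_mod_cast hb.ne') (by exact_mod_cast ha.ne'),
    padicValRat.of_nat, padicValRat.of_nat]
  have hpa : padicValNat p a = 0 := by
    apply padicValNat.eq_zero_of_not_dvd
    intro hdvd
    have hpb : p ∣ b := Nat.dvd_of_mem_primeFactors hp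
    have hg : p ∣ Nat.gcd a b := Nat.dvd_gcd hdvd hpb
    rw [hcop.gcd_eq_one, Nat.dvd_one] at hg
    exact hpp.one_lt.ne' hg
  rw [hpa, ← Nat.factorization_def b hpp]
  push_cast; ring

/-- **(12): the congruence at a prime of `x`.** For `p ∣ a`:
`ord_p((z/y) − 1) = ord_p(x/y) = ord_p x`, with `z/y = ∏_{q ∣ yz} q^{e_q}`.
[cite: StewartYu1991, (12)] -/
theorem padicValRat_route_a (h : IsABCTriple a b c) {p : ℕ} (hp : p ∈ a.primeFactors) :
    padicValRat p (∏ q ∈ (c * b).primeFactors, (q : ℚ) ^ expDiff c b q - 1) =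
      a.factorization p := by
  obtain ⟨ha, hb, habc, hcop⟩ := id h
  have hc : c ≠ 0 := by omega
  have hpp : p.Prime := Nat.prime_of_mem_primeFactors hp
  haveI : Fact p.Prime := ⟨hpp⟩
  have hcb : c.Coprime b := (coprime_right_of_isABCTriple h).symm
  rw [← cast_div_eq_prod_zpow hc hb.ne' hcb]
  have hq : (c : ℚ) / b - 1 = (a : ℚ) / b := by
    rw [← habc]; push_cast; field_simp; ring
  rw [hq, padicValRat.div (by exact_mod_cast ha.ne') (by exact_mod_cast hb.ne'),
    padicValRat.of_nat, padicValRat.of_nat]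
  have hpb : padicValNat p b = 0 := by
    apply padicValNat.eq_zero_of_not_dvd
    intro hdvd
    have hpa : p ∣ a := Nat.dvd_of_mem_primeFactors hp
    have hg : p ∣ Nat.gcd a b := Nat.dvd_gcd hpa hdvd
    rw [hcop.gcd_eq_one, Nat.dvd_one] at hg
    exact hpp.one_lt.ne' hg
  rw [hpb, ← Nat.factorization_def a hpp]
  push_cast; ring

/-- **(10): the congruence at a prime of `z`.** For `p ∣ c` and `x ≠ y`:
`ord_p z ≤ ord_p((x/y)² − 1)` (`(x/y)² − 1 = (x − y) z / y²`), with
`(x/y)² = ∏_{q ∣ xy} q^{2 e_q}`. The paper uses the fourth power; the square already removes the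
sign of `−x/y`. [cite: StewartYu1991, (10)] -/
theorem le_padicValRat_route_c (h : IsABCTriple a b c) (hab : a ≠ b) {p : ℕ}
    (hp : p ∈ c.primeFactors) :
    (c.factorization p : ℝ) ≤
      padicValRat p (∏ q ∈ (a * b).primeFactors, (q : ℚ) ^ (2 * expDiff a b q) - 1) := by
  obtain ⟨ha, hb, habc, hcop⟩ := id h
  have hc : c ≠ 0 := by omega
  have hpp : p.Prime := Nat.prime_of_mem_primeFactors hp
  haveI : Fact p.Prime := ⟨hpp⟩
  have hprod : ∏ q ∈ (a * b).primeFactors, (q : ℚ) ^ (2 * expDiff a b q) =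
      ((a : ℚ) / b) ^ 2 := by
    rw [cast_div_eq_prod_zpow ha.ne' hb.ne' hcop, ← Finset.prod_pow]
    refine Finset.prod_congr rfl fun q _ => ?_
    rw [mul_comm, zpow_mul]; norm_cast
  rw [hprod]
  have hq : ((a : ℚ) / b) ^ 2 - 1 = (((a : ℤ) - b : ℤ) : ℚ) * (c : ℚ) / (b : ℚ) ^ 2 := by
    rw [← habc]; push_cast; field_simp; ring
  have hab0 : (((a : ℤ) - b : ℤ) : ℚ) ≠ 0 := by
    have : (a : ℤ) - b ≠ 0 := sub_ne_zero.mpr (by exact_mod_cast hab)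
    exact_mod_cast this
  have hc0 : (c : ℚ) ≠ 0 := by exact_mod_cast hc
  have hb0 : (b : ℚ) ≠ 0 := by exact_mod_cast hb.ne'
  rw [hq, padicValRat.div (mul_ne_zero hab0 hc0) (pow_ne_zero 2 hb0),
    padicValRat.mul hab0 hc0, padicValRat.pow, padicValRat.of_nat, padicValRat.of_nat,
    padicValRat.of_int]
  have hpb : padicValNat p b = 0 := by
    apply padicValNat.eq_zero_of_not_dvd
    intro hdvd
    have hpc : p ∣ c := Nat.dvd_of_mem_primeFactors hp
    have hg : p ∣ Nat.gcd b c := Nat.dvd_gcd hdvd hpc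
    rw [(coprime_right_of_isABCTriple h).gcd_eq_one, Nat.dvd_one] at hg
    exact hpp.one_lt.ne' hg
  rw [hpb, ← Nat.factorization_def c hpp]
  push_cast
  have : (0 : ℝ) ≤ (padicValInt p ((a : ℤ) - b) : ℝ) := Nat.cast_nonneg _
  linarith

/-- The exponents `e_q = ν_q(u) − ν_q(v)` of `u/v` are at most `3 log c` in absolute value when
`uv ≤ c²` (`ν_q(uv) ≤ (3/2) log(uv)`). [folklore] -/
theorem abs_expDiff_le {u v : ℕ} (hu : u ≠ 0) (hv : v ≠ 0) (huv : u.Coprime v)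
    (huc : u ≤ c) (hvc : v ≤ c) (q : ℕ) (hq : q.Prime) :
    (|expDiff u v q| : ℝ) ≤ 3 * Real.log c := by
  have hc : (1 : ℝ) ≤ c := by
    have : 1 ≤ c := le_trans (Nat.one_le_iff_ne_zero.mpr hu) huc
    exact_mod_cast this
  have h1 : (|expDiff u v q| : ℝ) = ((u * v).factorization q : ℕ) := by
    rw [← natAbs_expDiff hu hv huv q]
    simp only [Nat.cast_natAbs, Int.cast_abs]
  rw [h1]
  have h2 := factorization_le_log (mul_ne_zero hu hv) hq (p := q)
  have h3 : Real.log ((u * v : ℕ) : ℝ) ≤ 2 * Real.log c := by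
    have huv2 : ((u * v : ℕ) : ℝ) ≤ (c : ℝ) ^ 2 := by
      have : u * v ≤ c * c := Nat.mul_le_mul huc hvc
      calc ((u * v : ℕ) : ℝ) ≤ ((c * c : ℕ) : ℝ) := by exact_mod_cast this
        _ = (c : ℝ) ^ 2 := by push_cast; ring
    calc Real.log ((u * v : ℕ) : ℝ) ≤ Real.log ((c : ℝ) ^ 2) :=
          Real.log_le_log (by exact_mod_cast Nat.pos_of_ne_zero (mul_ne_zero hu hv)) huv2
      _ = 2 * Real.log c := by rw [Real.log_pow]; norm_num
  linarith

/-- `u/v ≠ 1` as a product over the primes of `uv` (`u ≠ v` coprime and positive). [folklore] -/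
theorem prod_zpow_expDiff_ne_one {u v : ℕ} (hu : u ≠ 0) (hv : v ≠ 0) (huv : u.Coprime v)
    (hne : u ≠ v) : ∏ q ∈ (u * v).primeFactors, (q : ℚ) ^ expDiff u v q ≠ 1 := by
  rw [← cast_div_eq_prod_zpow hu hv huv]
  intro h1
  rw [div_eq_one_iff_eq (by exact_mod_cast hv)] at h1
  exact hne (by exact_mod_cast h1)

/-- `(a/b)² ≠ 1` as a product over the primes of `ab` (`a ≠ b` coprime and positive).
[folklore] -/
theorem prod_zpow_two_mul_expDiff_ne_one (hu : a ≠ 0) (hv : b ≠ 0) (huv : a.Coprime b)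
    (hne : a ≠ b) : ∏ q ∈ (a * b).primeFactors, (q : ℚ) ^ (2 * expDiff a b q) ≠ 1 := by
  have hprod : ∏ q ∈ (a * b).primeFactors, (q : ℚ) ^ (2 * expDiff a b q) =
      ((a : ℚ) / b) ^ 2 := by
    rw [cast_div_eq_prod_zpow hu hv huv, ← Finset.prod_pow]
    refine Finset.prod_congr rfl fun q _ => ?_
    rw [mul_comm, zpow_mul]; norm_cast
  rw [hprod]
  intro h1
  have hpos : (0 : ℚ) ≤ (a : ℚ) / b := by positivity
  have h2 : (a : ℚ) / b = 1 := (pow_eq_one_iff_of_nonneg hpos two_ne_zero).mp h1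
  rw [div_eq_one_iff_eq (by exact_mod_cast hv)] at h2
  exact hne (by exact_mod_cast h2)

end Routes

/-! ### The endgame in `log c` -/

section Endgame

/-- **Resolution of the implicit inequality** `u³ ≤ K³ G^{3θ} log(6u)³` (`u = log c`): for
`0 < ε ≤ 1/2`, `u ≤ (6K/ε)^{1/(1−ε)} · G^{θ/(1−ε)}` (`log(6u) ≤ (6u)^ε/ε`).
[cite: StewartYu1991, (18)] -/
theorem le_of_pow_three_le_log {K θ ε u G : ℝ} (hK : 1 ≤ K) (hε : 0 < ε) (hε2 : ε ≤ 1 / 2)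
    (hu : 1 ≤ u) (hG : 1 ≤ G)
    (h : u ^ 3 ≤ K ^ 3 * G ^ (3 * θ) * Real.log (6 * u) ^ 3) :
    u ≤ (6 * K / ε) ^ (1 / (1 - ε)) * G ^ (θ / (1 - ε)) := by
  have hG0 : 0 ≤ G := by linarith
  have hlog6u : 0 < Real.log (6 * u) := Real.log_pos (by linarith)
  -- cube root
  have h1 : u ≤ K * G ^ θ * Real.log (6 * u) := by
    have hcube : K ^ 3 * G ^ (3 * θ) * Real.log (6 * u) ^ 3 = (K * G ^ θ * Real.log (6 * u)) ^ 3 := by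
      rw [show (3 : ℝ) * θ = θ * ((3 : ℕ) : ℝ) by push_cast; ring, Real.rpow_mul hG0,
        Real.rpow_natCast]
      ring
    rw [hcube] at h
    exact le_of_pow_le_pow_left₀ (by norm_num) (by positivity) h
  -- `log(6u) ≤ 6 u^ε / ε`
  have h2 : Real.log (6 * u) ≤ 6 * u ^ ε / ε := by
    have h3 : Real.log (6 * u) ≤ (6 * u) ^ ε / ε := Real.log_le_rpow_div (by linarith) hε
    have h4 : (6 * u) ^ ε ≤ 6 * u ^ ε := by
      rw [Real.mul_rpow (by norm_num) (by linarith)]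
      have h6 : (6 : ℝ) ^ ε ≤ 6 := by
        calc (6 : ℝ) ^ ε ≤ 6 ^ (1 : ℝ) :=
              Real.rpow_le_rpow_of_exponent_le (by norm_num) (by linarith)
          _ = 6 := Real.rpow_one 6
      exact mul_le_mul_of_nonneg_right h6 (by positivity)
    exact h3.trans (div_le_div_of_nonneg_right h4 hε.le)
  set M : ℝ := 6 * K / ε * G ^ θ with hM
  have h5 : u ≤ M * u ^ ε := by
    calc u ≤ K * G ^ θ * Real.log (6 * u) := h1
      _ ≤ K * G ^ θ * (6 * u ^ ε / ε) := mul_le_mul_of_nonneg_left h2 (by positivity)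
      _ = M * u ^ ε := by rw [hM]; field_simp
  -- `u^{1-ε} ≤ M`
  have hu0 : 0 < u := by linarith
  have huε : 0 < u ^ ε := Real.rpow_pos_of_pos hu0 ε
  have h6 : u ^ (1 - ε) ≤ M := by
    rw [Real.rpow_sub hu0, Real.rpow_one, div_le_iff₀ huε]
    exact h5
  have h1ε : 0 < 1 - ε := by linarith
  have h7 : u = (u ^ (1 - ε)) ^ (1 / (1 - ε)) := by
    rw [← Real.rpow_mul hu0.le, mul_one_div_cancel h1ε.ne', Real.rpow_one]
  calc u = (u ^ (1 - ε)) ^ (1 / (1 - ε)) := h7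
    _ ≤ M ^ (1 / (1 - ε)) := Real.rpow_le_rpow (by positivity) h6 (by positivity)
    _ = (6 * K / ε) ^ (1 / (1 - ε)) * G ^ (θ / (1 - ε)) := by
        rw [hM, Real.mul_rpow (by positivity) (by positivity), ← Real.rpow_mul hG0]
        congr 2; field_simp

end Endgame

/-! ### §3 of the paper: the three routes -/

section ThreeRoutes

variable (Cw : ℕ → ℝ)

/-- `1 ≤ ∏_{q ∈ U} log max(4, q)`. [folklore] -/
theorem one_le_prod_log_max_four (U : Finset ℕ) : 1 ≤ ∏ q ∈ U, Real.log ((max 4 q : ℕ) : ℝ) := by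
  have hlog4 : (1 : ℝ) ≤ Real.log 4 := by
    rw [← Real.log_exp 1]
    apply Real.log_le_log (Real.exp_pos 1)
    have := Real.exp_one_lt_d9; linarith
  calc (1 : ℝ) = ∏ _q ∈ U, (1 : ℝ) := Finset.prod_const_one.symm
    _ ≤ ∏ q ∈ U, Real.log ((max 4 q : ℕ) : ℝ) := by
        apply Finset.prod_le_prod (fun _ _ => zero_le_one)
        intro q _
        have h4 : (4 : ℝ) ≤ ((max 4 q : ℕ) : ℝ) := by exact_mod_cast le_max_left 4 q
        exact hlog4.trans (Real.log_le_log (by norm_num) h4)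

/-- `(c' n)^n ≤ (C r)^n` for `|c'| ≤ C` and `n ≤ r` (also when `c' < 0`). [folklore] -/
theorem mul_pow_le_mul_pow_of_abs_le {c' C : ℝ} {n r : ℕ} (hc' : |c'| ≤ C) (hn : n ≤ r) :
    (c' * n) ^ n ≤ (C * r) ^ n := by
  have hC0 : 0 ≤ C := (abs_nonneg c').trans hc'
  calc (c' * n) ^ n ≤ |(c' * n) ^ n| := le_abs_self _
    _ = (|c'| * n) ^ n := by rw [abs_pow, abs_mul, Nat.abs_cast]
    _ ≤ (C * r) ^ n := by
        apply pow_le_pow_left₀ (by positivity)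
        exact mul_le_mul hc' (by exact_mod_cast hn) (Nat.cast_nonneg _) hC0

/-- **The `p`-adic route through a member `w`** (`w` coprime to `uv`, all inside the triple):
if `ord_p w ≤ ord_p(∏_{q ∣ uv} q^{e_q} − 1)` for every `p ∣ w` (the congruences (10)–(12)), with
`|e_q| ≤ B`, `B ≥ 3`, then by Lemma 1 of the paper (binder `hY`, see
`log_pow_three_le_of_yu1990_waldschmidt1980`) and the max-ord device (9):
`log w ≤ (C r)^{ω(uv)} · P(w)² · ∏_{q ∣ uv} log max(4, q) · (log B · (log G)²)`, where
`|c₅| ≤ C`, `ω(uv) ≤ r`, `P(w)` is the largest prime factor of `w`, `G ≥ 4` bounds the primes of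
`uv` and `rad(w)`. [cite: StewartYu1991, (9)–(14)] -/
theorem log_le_of_padicRoute (c₅ : ℝ)
    (hY : ∀ (p : ℕ), p.Prime → ∀ (S : Finset ℕ), (∀ q ∈ S, q.Prime) → p ∉ S → S.Nonempty →
      ∀ (e : ℕ → ℤ) (B : ℝ), 3 ≤ B → (∀ q ∈ S, (|e q| : ℝ) ≤ B) →
      ∏ q ∈ S, (q : ℚ) ^ e q ≠ 1 →
      (padicValRat p (∏ q ∈ S, (q : ℚ) ^ e q - 1) : ℝ) <
        (c₅ * S.card) ^ S.card * (p : ℝ) ^ 2 * Real.log B *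
          Real.log (Real.log ((max 4 (S.sup id) : ℕ) : ℝ)) *
          ∏ q ∈ S, Real.log ((max 4 q : ℕ) : ℝ))
    {C : ℝ} {r : ℕ} (hc₅C : |c₅| ≤ C) {G : ℝ} (hG4 : 4 ≤ G) {B : ℝ} (hB3 : 3 ≤ B)
    {w u v : ℕ} (e : ℕ → ℤ) (hw : w ≠ 0) (hwuv : w.Coprime (u * v))
    (hne : (u * v).primeFactors.Nonempty) (hnr : (u * v).primeFactors.card ≤ r)
    (hqG : ∀ q ∈ (u * v).primeFactors, (q : ℝ) ≤ G)
    (hwG : ∏ p ∈ w.primeFactors, (p : ℝ) ≤ G)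
    (heB : ∀ q ∈ (u * v).primeFactors, (|e q| : ℝ) ≤ B)
    (hne1 : ∏ q ∈ (u * v).primeFactors, (q : ℚ) ^ e q ≠ 1)
    (hval : ∀ p ∈ w.primeFactors, (w.factorization p : ℝ) ≤
      padicValRat p (∏ q ∈ (u * v).primeFactors, (q : ℚ) ^ e q - 1)) :
    Real.log w ≤ (C * r) ^ (u * v).primeFactors.card * (largestPrimeFactor w : ℝ) ^ 2 *
      (∏ q ∈ (u * v).primeFactors, Real.log ((max 4 q : ℕ) : ℝ)) *
      (Real.log B * Real.log G ^ 2) := by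
  classical
  set T := (u * v).primeFactors with hT
  set n := T.card with hn
  set PL := ∏ q ∈ T, Real.log ((max 4 q : ℕ) : ℝ) with hPL
  set Pw : ℝ := (largestPrimeFactor w : ℝ) with hPw
  set LG := Real.log G with hLG
  have hC0 : 0 ≤ C := (abs_nonneg c₅).trans hc₅C
  have hG1 : (1 : ℝ) ≤ G := by linarith
  have hLG1 : 1 ≤ LG := by
    rw [hLG, ← Real.log_exp 1]
    apply Real.log_le_log (Real.exp_pos 1)
    have := Real.exp_one_lt_d9; linarith
  have hLG0 : 0 ≤ LG := by linarith
  have hlogB : 0 ≤ Real.log B := Real.log_nonneg (by linarith)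
  have hPL1 : 1 ≤ PL := one_le_prod_log_max_four T
  have hTprime : ∀ q ∈ T, q.Prime := fun q hq => Nat.prime_of_mem_primeFactors hq
  set M : ℝ := (C * r) ^ n * Pw ^ 2 * Real.log B * LG * PL with hM
  have hCr0 : 0 ≤ (C * r) ^ n := pow_nonneg (by positivity) n
  have hM0 : 0 ≤ M := by rw [hM]; positivity
  -- the factor `log log A ≤ log G`
  have hA : Real.log (Real.log ((max 4 (T.sup id) : ℕ) : ℝ)) ≤ LG := by
    have hA4 : (4 : ℝ) ≤ ((max 4 (T.sup id) : ℕ) : ℝ) := by exact_mod_cast le_max_left _ _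
    have hAG : ((max 4 (T.sup id) : ℕ) : ℝ) ≤ G := by
      have : ((max 4 (T.sup id) : ℕ) : ℝ) = max (4 : ℝ) ((T.sup id : ℕ) : ℝ) := by
        push_cast; rfl
      rw [this]
      refine max_le hG4 ?_
      obtain ⟨q, hq, hsup⟩ := Finset.exists_mem_eq_sup T hne id
      rw [hsup]; exact hqG q hq
    have hlogA : 0 < Real.log ((max 4 (T.sup id) : ℕ) : ℝ) := Real.log_pos (by linarith)
    calc Real.log (Real.log ((max 4 (T.sup id) : ℕ) : ℝ))
        ≤ Real.log ((max 4 (T.sup id) : ℕ) : ℝ) - 1 := Real.log_le_sub_one_of_pos hlogA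
      _ ≤ Real.log G - 1 := by linarith [Real.log_le_log (by linarith) hAG]
      _ ≤ LG := by rw [hLG]; linarith
  have hlogA0 : 0 ≤ Real.log (Real.log ((max 4 (T.sup id) : ℕ) : ℝ)) := by
    apply Real.log_nonneg
    rw [← Real.log_exp 1]
    apply Real.log_le_log (Real.exp_pos 1)
    have h4 : (4 : ℝ) ≤ ((max 4 (T.sup id) : ℕ) : ℝ) := by exact_mod_cast le_max_left _ _
    have := Real.exp_one_lt_d9; linarith
  -- every exponent of `w` is at most `M`
  have hbound : ∀ p ∈ w.primeFactors, (w.factorization p : ℝ) ≤ M := by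
    intro p hp
    have hpp : p.Prime := Nat.prime_of_mem_primeFactors hp
    have hpT : p ∉ T := by
      intro hpT
      have h1 : p ∣ w := Nat.dvd_of_mem_primeFactors hp
      have h2 : p ∣ u * v := Nat.dvd_of_mem_primeFactors hpT
      have hg : p ∣ Nat.gcd w (u * v) := Nat.dvd_gcd h1 h2
      rw [hwuv.gcd_eq_one, Nat.dvd_one] at hg
      exact hpp.one_lt.ne' hg
    have key := hY p hpp T hTprime hpT hne e B hB3 heB hne1
    have hpP : (p : ℝ) ^ 2 ≤ Pw ^ 2 := by
      have : (p : ℝ) ≤ Pw := by rw [hPw]; exact_mod_cast le_largestPrimeFactor_of_mem_primeFactors hp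
      exact pow_le_pow_left₀ (Nat.cast_nonneg _) this 2
    have hZ0 : 0 ≤ (p : ℝ) ^ 2 * Real.log B * Real.log (Real.log ((max 4 (T.sup id) : ℕ) : ℝ)) * PL := by
      positivity
    have step1 : (c₅ * n) ^ n * (p : ℝ) ^ 2 * Real.log B *
          Real.log (Real.log ((max 4 (T.sup id) : ℕ) : ℝ)) * PL ≤
        (C * r) ^ n * ((p : ℝ) ^ 2 * Real.log B *
          Real.log (Real.log ((max 4 (T.sup id) : ℕ) : ℝ)) * PL) := by
      rw [show (c₅ * n) ^ n * (p : ℝ) ^ 2 * Real.log B *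
          Real.log (Real.log ((max 4 (T.sup id) : ℕ) : ℝ)) * PL =
          (c₅ * n) ^ n * ((p : ℝ) ^ 2 * Real.log B *
          Real.log (Real.log ((max 4 (T.sup id) : ℕ) : ℝ)) * PL) by ring]
      exact mul_le_mul_of_nonneg_right (mul_pow_le_mul_pow_of_abs_le hc₅C hnr) hZ0
    have step2 : (p : ℝ) ^ 2 * Real.log B * Real.log (Real.log ((max 4 (T.sup id) : ℕ) : ℝ)) * PL ≤
        Pw ^ 2 * Real.log B * LG * PL := by
      apply mul_le_mul_of_nonneg_right _ (by linarith)
      exact mul_le_mul (mul_le_mul_of_nonneg_right hpP hlogB) hA hlogA0 (by positivity)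
    calc (w.factorization p : ℝ)
        ≤ padicValRat p (∏ q ∈ T, (q : ℚ) ^ e q - 1) := hval p hp
      _ ≤ (c₅ * n) ^ n * (p : ℝ) ^ 2 * Real.log B *
          Real.log (Real.log ((max 4 (T.sup id) : ℕ) : ℝ)) * PL := key.le
      _ ≤ (C * r) ^ n * (Pw ^ 2 * Real.log B * LG * PL) :=
          step1.trans (mul_le_mul_of_nonneg_left step2 hCr0)
      _ = M := by rw [hM]; ring
  -- (9)
  have h9 := log_le_mul_log_prod_primeFactors hw hbound
  have hradw : Real.log (∏ p ∈ w.primeFactors, (p : ℝ)) ≤ LG := by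
    rw [hLG]
    apply Real.log_le_log _ hwG
    exact Finset.prod_pos fun q hq => by exact_mod_cast (Nat.prime_of_mem_primeFactors hq).pos
  calc Real.log w ≤ M * Real.log (∏ p ∈ w.primeFactors, (p : ℝ)) := h9
    _ ≤ M * LG := mul_le_mul_of_nonneg_left hradw hM0
    _ = (C * r) ^ n * Pw ^ 2 * PL * (Real.log B * LG ^ 2) := by rw [hM]; ring
set_option maxHeartbeats 400000 in -- buildfix (bf3-g26): 160k/180k FAIL, 200k PASS at accept time; line-neutral budget line
/-- **The archimedean route (16) when `x < √y`.** For an abc triple with `a² < b`: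
`0 < Λ = log(c/b) ≤ a/b` and `Λ² c < 2`, so `log c < log 2 − 2 log Λ`, and Lemma 2 of the
paper for `Λ = ∑_{q ∣ bc} e_q log q` (binder `hW₂` with `0 ≤ Cw(n) ≤ (c₆ n)ⁿ`, through
`arch_lower_bound_primes_sorted`) gives
`log c ≤ 16 · (C r)^{ω(bc)} · ∏_{q ∣ bc} log max(4,q) · (log(6 log c) · Λ₁²)`
(`2|c₆| ≤ C`, `1 ≤ C r`, `ω(bc) ≤ r`, `log max(4, q) ≤ Λ₁` on the primes of `bc`,
`log(2Λ₁) ≤ Λ₁`, `Λ₁ ≥ 1`). [cite: StewartYu1991, (15)–(16)] -/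
theorem log_le_of_archRoute (c₆ : ℝ) (hCw : ∀ n, 0 ≤ Cw n) (hCwle : ∀ n, Cw n ≤ (c₆ * n) ^ n)
    (hW₂ : ∀ (n : ℕ) (α : Fin (n + 1) → ℚ) (b : Fin (n + 1) → ℤ) (V : Fin (n + 1) → ℝ) (W : ℝ),
      (∀ j, 0 < α j ∧ α j ≠ 1) →
      Module.finrank ℚ ↥(IntermediateField.adjoin ℚ
          (Set.range fun j => Real.sqrt (α j : ℝ))) = 2 ^ (n + 1) →
      Monotone V → 1 ≤ V 0 →
      (∀ j, max (logHeight₁ (α j)) |Real.log (α j : ℝ)| ≤ V j) →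
      0 < W → (∀ j, logHeight₁ (b j : ℚ) ≤ W) →
      ∑ j, (b j : ℝ) * Real.log (α j : ℝ) ≠ 0 →
      Real.exp (-(Cw (n + 1) * (∏ j, V j) * (W + Real.log (2 * V (Fin.last n))) *
          Real.log (2 * (if n = 0 then 1 else V ⟨n - 1, by omega⟩)) / Real.log 2 ^ (n + 2))) <
        |∑ j, (b j : ℝ) * Real.log (α j : ℝ)|)
    {C : ℝ} {r : ℕ} (hc₆C : 2 * |c₆| ≤ C) (hCr1 : 1 ≤ C * r)
    {Λ₁ : ℝ} (hΛ₁ : 1 ≤ Λ₁) (h2Λ₁ : Real.log (2 * Λ₁) ≤ Λ₁)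
    {a b c : ℕ} (h : IsABCTriple a b c) (hab : a ≤ b) (hc3 : 3 ≤ c) (hcase : a ^ 2 < b)
    (hnr : (c * b).primeFactors.card ≤ r)
    (hlog4 : ∀ q ∈ (c * b).primeFactors, Real.log ((max 4 q : ℕ) : ℝ) ≤ Λ₁) :
    Real.log c ≤ 16 * ((C * r) ^ (c * b).primeFactors.card *
      (∏ q ∈ (c * b).primeFactors, Real.log ((max 4 q : ℕ) : ℝ)) *
      (Real.log (6 * Real.log c) * Λ₁ ^ 2)) := by
  classical
  obtain ⟨ha, hb, habc, hcop⟩ := id h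
  have hc0 : c ≠ 0 := by omega
  have hb0 : b ≠ 0 := hb.ne'
  have hbc : b.Coprime c := coprime_right_of_isABCTriple h
  set T := (c * b).primeFactors with hT
  set n := T.card with hn
  set PL := ∏ q ∈ T, Real.log ((max 4 q : ℕ) : ℝ) with hPL
  set Lc := Real.log (6 * Real.log c) with hLc
  have hPL1 : 1 ≤ PL := one_le_prod_log_max_four T
  have hc3r : (3 : ℝ) ≤ c := by exact_mod_cast hc3
  have hlogc1 : 1 ≤ Real.log c := by
    rw [← Real.log_exp 1]
    apply Real.log_le_log (Real.exp_pos 1)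
    have := Real.exp_one_lt_d9; linarith
  have hLc1 : 1 ≤ Lc := by
    rw [hLc, ← Real.log_exp 1]
    apply Real.log_le_log (Real.exp_pos 1)
    have := Real.exp_one_lt_d9; linarith
  have hΛ₁0 : 0 ≤ Λ₁ := by linarith
  have hTne : T.Nonempty := by
    rw [hT, Nat.primeFactors_mul hc0 hb0]
    exact (Nat.nonempty_primeFactors.mpr (by omega)).mono Finset.subset_union_left
  -- the linear form `Λ = log(c/b) = ∑_{q ∣ bc} e_q log q`, `0 < Λ ≤ a/b`, `Λ² c < 2`
  set Λ : ℝ := ∑ q ∈ T, (expDiff c b q : ℝ) * Real.log q with hΛdef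
  have hΛeq : Λ = Real.log ((c : ℝ) / b) := by
    have h1 : ((c : ℚ) / b : ℚ) = ∏ q ∈ T, (q : ℚ) ^ expDiff c b q :=
      cast_div_eq_prod_zpow hc0 hb0 hbc.symm
    have h2 : ((c : ℝ) / b) = ∏ q ∈ T, (q : ℝ) ^ expDiff c b q := by
      have := congrArg (fun x : ℚ => (x : ℝ)) h1
      push_cast at this
      exact this
    rw [h2, Real.log_prod]
    · refine Finset.sum_congr rfl fun q _ => ?_
      rw [Real.log_zpow]
    · intro q hq
      exact zpow_ne_zero _ (by exact_mod_cast (Nat.prime_of_mem_primeFactors hq).ne_zero)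
  have hbr : (0 : ℝ) < b := by exact_mod_cast hb
  have hcr : (0 : ℝ) < c := by exact_mod_cast (show 0 < c by omega)
  have hcb1 : (1 : ℝ) < (c : ℝ) / b := by
    rw [one_lt_div hbr]; exact_mod_cast (show b < c by omega)
  have hΛpos : 0 < Λ := by rw [hΛeq]; exact Real.log_pos hcb1
  have hΛle : Λ ≤ (a : ℝ) / b := by
    rw [hΛeq]
    have := Real.log_le_sub_one_of_pos (by linarith : (0 : ℝ) < c / b)
    have hcab : (c : ℝ) / b - 1 = a / b := by
      rw [← habc]; push_cast; field_simp; ring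
    linarith
  have hΛsq : Λ ^ 2 * c < 2 := by
    have h1 : Λ ^ 2 ≤ ((a : ℝ) / b) ^ 2 := pow_le_pow_left₀ hΛpos.le hΛle 2
    have h2 : ((a : ℝ) / b) ^ 2 * b < 1 := by
      have hab2 : ((a : ℝ)) ^ 2 < b := by exact_mod_cast hcase
      rw [div_pow, div_mul_eq_mul_div, div_lt_one (by positivity)]
      nlinarith
    have h3 : (c : ℝ) ≤ 2 * b := by exact_mod_cast (show c ≤ 2 * b by omega)
    nlinarith [sq_nonneg Λ]
  have hlogc : Real.log c < Real.log 2 - 2 * Real.log Λ := by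
    have h1 : Real.log (Λ ^ 2 * c) < Real.log 2 := Real.log_lt_log (by positivity) hΛsq
    rw [Real.log_mul (by positivity) hcr.ne', Real.log_pow] at h1
    push_cast at h1
    linarith
  -- Lemma 2
  have harch := arch_lower_bound_primes_sorted Cw hCw hW₂ T
    (fun q hq => Nat.prime_of_mem_primeFactors hq) hTne (expDiff c b) hΛ₁ hlog4
    (show (1 : ℝ) ≤ 6 * Real.log c by linarith)
    (by
      intro q hq
      have := abs_expDiff_le hc0 hb0 hbc.symm le_rfl (by omega : b ≤ c) q
        (Nat.prime_of_mem_primeFactors hq)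
      linarith)
    hΛpos.ne'
  rw [abs_of_pos hΛpos] at harch
  -- the size of the exponent in Lemma 2
  have hlog2 : (1 / 2 : ℝ) ≤ Real.log 2 := by have := Real.log_two_gt_d9; linarith
  have hWfac : (Real.log (Real.exp 1 * (6 * Real.log c)) + Real.log (2 * Λ₁)) * Real.log (2 * Λ₁) ≤
      3 * (Lc * Λ₁ ^ 2) := by
    have h1 : Real.log (Real.exp 1 * (6 * Real.log c)) = 1 + Lc := by
      rw [Real.log_mul (Real.exp_pos 1).ne' (by linarith), Real.log_exp, hLc]
    rw [h1]
    have h2 : 0 ≤ Real.log (2 * Λ₁) := Real.log_nonneg (by linarith)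
    have h3 : (1 + Lc + Λ₁) ≤ 3 * (Lc * Λ₁) := by nlinarith
    calc (1 + Lc + Real.log (2 * Λ₁)) * Real.log (2 * Λ₁) ≤ (1 + Lc + Λ₁) * Λ₁ :=
          mul_le_mul (by linarith) h2Λ₁ h2 (by linarith)
      _ ≤ 3 * (Lc * Λ₁) * Λ₁ := mul_le_mul_of_nonneg_right h3 hΛ₁0
      _ = 3 * (Lc * Λ₁ ^ 2) := by ring
  have hU0 : 0 ≤ PL * ((Real.log (Real.exp 1 * (6 * Real.log c)) + Real.log (2 * Λ₁)) *
      Real.log (2 * Λ₁)) := by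
    have h1 : 0 ≤ Real.log (Real.exp 1 * (6 * Real.log c)) :=
      Real.log_nonneg (by nlinarith [Real.add_one_le_exp (1 : ℝ)])
    have h2 : 0 ≤ Real.log (2 * Λ₁) := Real.log_nonneg (by linarith)
    positivity
  -- `Cw n / (log 2)^{n+1} ≤ 2 (C r)^n`
  have hCwn : Cw n / Real.log 2 ^ (n + 1) ≤ 2 * (C * r) ^ n := by
    have h1 : Cw n ≤ (|c₆| * n) ^ n := by
      calc Cw n ≤ (c₆ * n) ^ n := hCwle n
        _ ≤ |(c₆ * n) ^ n| := le_abs_self _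
        _ = (|c₆| * n) ^ n := by rw [abs_pow, abs_mul, Nat.abs_cast]
    have h2 : (2 * |c₆| * n) ^ n ≤ (C * r) ^ n :=
      mul_pow_le_mul_pow_of_abs_le (by rw [abs_mul, Nat.abs_ofNat, abs_abs]; exact hc₆C) hnr
    have h3 : (1 / 2 : ℝ) ^ (n + 1) ≤ Real.log 2 ^ (n + 1) := pow_le_pow_left₀ (by norm_num) hlog2 _
    rw [div_le_iff₀ (by positivity)]
    have hhalf : (2 : ℝ) ^ n * (1 / 2) ^ n = 1 := by rw [← mul_pow]; norm_num
    calc Cw n ≤ (|c₆| * n) ^ n := h1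
      _ = 2 * (2 * |c₆| * n) ^ n * (1 / 2) ^ (n + 1) := by
          have e1 : (2 * |c₆| * (n : ℝ)) ^ n = 2 ^ n * (|c₆| * n) ^ n := by
            rw [show (2 : ℝ) * |c₆| * n = 2 * (|c₆| * n) by ring, mul_pow]
          rw [e1, pow_succ]
          calc (|c₆| * (n : ℝ)) ^ n = (|c₆| * n) ^ n * ((2 : ℝ) ^ n * (1 / 2) ^ n) := by
                rw [hhalf, mul_one]
            _ = 2 * (2 ^ n * (|c₆| * n) ^ n) * ((1 / 2) ^ n * (1 / 2)) := by ring
      _ ≤ 2 * (C * r) ^ n * Real.log 2 ^ (n + 1) := by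
          apply mul_le_mul (mul_le_mul_of_nonneg_left h2 (by norm_num)) h3 (by positivity)
          exact mul_nonneg (by norm_num) (pow_nonneg (by nlinarith [abs_nonneg c₆]) n)
  -- assemble
  have hCrn : 1 ≤ (C * r) ^ n := one_le_pow₀ hCr1
  have hmain : -Real.log Λ ≤ 6 * ((C * r) ^ n * PL * (Lc * Λ₁ ^ 2)) := by
    have h1 : -Real.log Λ < Cw n * PL *
        ((Real.log (Real.exp 1 * (6 * Real.log c)) + Real.log (2 * Λ₁)) * Real.log (2 * Λ₁)) /
        Real.log 2 ^ (n + 1) := by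
      have := harch
      rw [show Cw T.card * PL * (Real.log (Real.exp 1 * (6 * Real.log c)) + Real.log (2 * Λ₁)) *
          Real.log (2 * Λ₁) = Cw n * PL * ((Real.log (Real.exp 1 * (6 * Real.log c)) +
          Real.log (2 * Λ₁)) * Real.log (2 * Λ₁)) by rw [hn]; ring] at this
      linarith
    have h2 : Cw n * PL *
        ((Real.log (Real.exp 1 * (6 * Real.log c)) + Real.log (2 * Λ₁)) * Real.log (2 * Λ₁)) /
        Real.log 2 ^ (n + 1) =
        Cw n / Real.log 2 ^ (n + 1) * (PL * ((Real.log (Real.exp 1 * (6 * Real.log c)) +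
          Real.log (2 * Λ₁)) * Real.log (2 * Λ₁))) := by ring
    rw [h2] at h1
    have h3 : Cw n / Real.log 2 ^ (n + 1) * (PL * ((Real.log (Real.exp 1 * (6 * Real.log c)) +
          Real.log (2 * Λ₁)) * Real.log (2 * Λ₁))) ≤
        2 * (C * r) ^ n * (PL * (3 * (Lc * Λ₁ ^ 2))) := by
      apply mul_le_mul hCwn (mul_le_mul_of_nonneg_left hWfac (by linarith)) hU0 (by positivity)
    linarith
  have hlog21 : Real.log 2 ≤ 1 := by have := Real.log_two_lt_d9; linarith
  have hbig : 1 ≤ (C * r) ^ n * PL * (Lc * Λ₁ ^ 2) := by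
    have : 1 ≤ Lc * Λ₁ ^ 2 := one_le_mul_of_one_le_of_one_le hLc1 (one_le_pow₀ hΛ₁)
    exact one_le_mul_of_one_le_of_one_le (one_le_mul_of_one_le_of_one_le hCrn hPL1) this
  linarith

end ThreeRoutes

/-! ### (17)–(18): the product of the three routes and Lemma 4 -/

section Main

variable (Cw : ℕ → ℝ)

/-- **(17), pure algebra:** the product of the three routes. [cite: StewartYu1991, (17)] -/
theorem pow_three_le_of_routes {u x Pa Pb Pc La Lb Lc Y : ℝ} {na nb nc : ℕ} (hu : 0 ≤ u)
    (hx : 0 ≤ x) (hLa : 0 ≤ La) (hLb : 0 ≤ Lb) (hLc : 0 ≤ Lc) (hY : 0 ≤ Y)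
    (hRc : u ≤ x ^ (na + nb) * Pc ^ 2 * (La * Lb) * Y)
    (hRb : u ≤ 4 * (x ^ (nc + na) * Pb ^ 2 * (Lc * La) * Y))
    (hRa : u ≤ 16 * (x ^ (nc + nb) * Pa ^ 2 * (Lc * Lb) * Y)) :
    u ^ 3 ≤ 64 * Y ^ 3 * (x ^ (na + nb + nc)) ^ 2 * (Pa * Pb * Pc) ^ 2 * (La * Lb * Lc) ^ 2 := by
  have h0c : 0 ≤ x ^ (na + nb) * Pc ^ 2 * (La * Lb) * Y := by positivity
  have h0b : 0 ≤ 4 * (x ^ (nc + na) * Pb ^ 2 * (Lc * La) * Y) := by positivity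
  calc u ^ 3 = u * u * u := by ring
    _ ≤ (x ^ (na + nb) * Pc ^ 2 * (La * Lb) * Y) * (4 * (x ^ (nc + na) * Pb ^ 2 * (Lc * La) * Y)) *
          (16 * (x ^ (nc + nb) * Pa ^ 2 * (Lc * Lb) * Y)) :=
        mul_le_mul (mul_le_mul hRc hRb hu h0c) hRa hu (mul_nonneg h0c h0b)
    _ = 64 * Y ^ 3 * (x ^ (na + nb + nc)) ^ 2 * (Pa * Pb * Pc) ^ 2 * (La * Lb * Lc) ^ 2 := by ring

/-- **Lemma 4 for all primes of `abc`:** `r^r ≤ 600^{r+1} · rad(abc)`, `r = ω(abc)`.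
[cite: StewartYu1991, Lemma 4] -/
theorem card_pow_card_le_rad (a b c : ℕ) :
    (((a * b * c).primeFactors.card : ℕ) : ℝ) ^ (a * b * c).primeFactors.card ≤
      600 ^ ((a * b * c).primeFactors.card + 1) * (rad a b c : ℝ) := by
  set S := (a * b * c).primeFactors with hS
  have hSprime : ∀ q ∈ S, q.Prime := fun q hq => Nat.prime_of_mem_primeFactors hq
  have h1 := pow_self_mul_prod_log_le hSprime (k := S.card) (by omega)
  have hPL := one_le_prod_log_max_four S
  have hrad : (rad a b c : ℝ) = ∏ q ∈ S, (q : ℝ) := by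
    rw [rad_def, Nat.radical_eq_prod_primeFactors]; push_cast; rfl
  rw [hrad]
  have h0 : 0 ≤ ((S.card : ℕ) : ℝ) ^ S.card := pow_nonneg (Nat.cast_nonneg _) _
  calc ((S.card : ℕ) : ℝ) ^ S.card = ((S.card : ℕ) : ℝ) ^ S.card * 1 := (mul_one _).symm
    _ ≤ ((S.card : ℕ) : ℝ) ^ S.card * ∏ q ∈ S, Real.log ((max 4 q : ℕ) : ℝ) :=
        mul_le_mul_of_nonneg_left hPL h0
    _ ≤ 600 ^ (S.card + 1) * ∏ q ∈ S, (q : ℝ) := h1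

set_option maxHeartbeats 800000 in
/-- **Stewart–Yu 1991, (13)·(14)·(16) ⟹ (17) ⟹ (18).** For an abc triple `a + b = c` with
`a ≤ b` and `c ≥ 3`, writing `r = ω(abc)`, `G = rad(abc)`, `C = 2 max{1, |c₅|, |c₆|}`:
`(log c)³ ≤ 23040000 · ((600 C)²)^r · G² · (log G)^{12} · (log(6 log c))³`, from
(Y) Lemma 1 of the paper in the form in which it is applied in (10)–(12) — for a prime `p`, a
    non-empty set `S` of primes not containing `p`, integers `e_q` with `|e_q| ≤ B`, `B ≥ 3`, and
    `Θ = ∏_{q ∈ S} q^{e_q} − 1 ≠ 0`: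
    `ord_p Θ < (c₅ #S)^{#S} · p² · log B · log log A · ∏_{q ∈ S} log max(4, q)`,
    `A = max(4, max S)` — i.e. Yu 1990, Corollary 2.3 (`n ≥ 2`) / Lemma 1.4 (`n = 1`) in
    `K = ℚ(ζ₄)` (`p > 2`) resp. `ℚ(ζ₆)` (`p = 2`) for the generators `q ∈ S` (with `2` replaced by
    `1 + i` when `p > 2`), whose Kummer condition is Lemma 3 of the paper; the fourth powers of
    the paper (`u − 1 ∣ u⁴ − 1`, `2⁴ = (1 + i)⁸`) only change `B` by a factor `≤ 8`, absorbed in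
    `c₅` as `log(8B) ≤ 3 log B` for `B ≥ 3`
    [cite: StewartYu1991, Lemma 1, Lemma 3, (10)–(12)] [cite: Yu1990, Corollary 2.3 (p. 32)];
(W) Lemma 2 of the paper = Waldschmidt 1980, Proposition 3.8 over `ℚ` with `q = 2` at `E = 2`
    — verbatim the binder `hW₂` of `BakerMethodBoundsKummerArchProofs` (whose Kummer condition
    for prime generators is again Lemma 3), with a constant function `0 ≤ Cw(n) ≤ (c₆ n)ⁿ`
    [cite: StewartYu1991, Lemma 2] [cite: Waldschmidt1980, Prop 3.8 (p. 274)].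
The routes are the paper's: the max-ord device (9); the congruences (10)–(12) with `B = 6 log c`
(`|e_q| ≤ 3 log c`); `log y ≥ log z / 4`; `x ≥ √y`, or Lemma 2 for `0 < log(z/y) < √2/√z`;
then (17) and Lemma 4 without the three largest primes `p_x, p_y, p_z`.
[cite: StewartYu1991, §3, (13)–(18)] -/
theorem log_pow_three_le_of_yu1990_waldschmidt1980 (c₅ c₆ : ℝ)
    (hCw : ∀ n, 0 ≤ Cw n) (hCwle : ∀ n, Cw n ≤ (c₆ * n) ^ n)
    (hY : ∀ (p : ℕ), p.Prime → ∀ (S : Finset ℕ), (∀ q ∈ S, q.Prime) → p ∉ S → S.Nonempty →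
      ∀ (e : ℕ → ℤ) (B : ℝ), 3 ≤ B → (∀ q ∈ S, (|e q| : ℝ) ≤ B) →
      ∏ q ∈ S, (q : ℚ) ^ e q ≠ 1 →
      (padicValRat p (∏ q ∈ S, (q : ℚ) ^ e q - 1) : ℝ) <
        (c₅ * S.card) ^ S.card * (p : ℝ) ^ 2 * Real.log B *
          Real.log (Real.log ((max 4 (S.sup id) : ℕ) : ℝ)) *
          ∏ q ∈ S, Real.log ((max 4 q : ℕ) : ℝ))
    (hW₂ : ∀ (n : ℕ) (α : Fin (n + 1) → ℚ) (b : Fin (n + 1) → ℤ) (V : Fin (n + 1) → ℝ) (W : ℝ),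
      (∀ j, 0 < α j ∧ α j ≠ 1) →
      Module.finrank ℚ ↥(IntermediateField.adjoin ℚ
          (Set.range fun j => Real.sqrt (α j : ℝ))) = 2 ^ (n + 1) →
      Monotone V → 1 ≤ V 0 →
      (∀ j, max (logHeight₁ (α j)) |Real.log (α j : ℝ)| ≤ V j) →
      0 < W → (∀ j, logHeight₁ (b j : ℚ) ≤ W) →
      ∑ j, (b j : ℝ) * Real.log (α j : ℝ) ≠ 0 →
      Real.exp (-(Cw (n + 1) * (∏ j, V j) * (W + Real.log (2 * V (Fin.last n))) *
          Real.log (2 * (if n = 0 then 1 else V ⟨n - 1, by omega⟩)) / Real.log 2 ^ (n + 2))) <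
        |∑ j, (b j : ℝ) * Real.log (α j : ℝ)|)
    {a b c : ℕ} (h : IsABCTriple a b c) (hab : a ≤ b) (hc3 : 3 ≤ c) :
    Real.log c ^ 3 ≤ 23040000 *
      ((600 * (2 * max (max 1 |c₅|) |c₆|)) ^ 2) ^ (a * b * c).primeFactors.card *
      (rad a b c : ℝ) ^ 2 * Real.log (rad a b c : ℝ) ^ 12 * Real.log (6 * Real.log c) ^ 3 := by
  classical
  obtain ⟨ha, hb, habc, hcop⟩ := id h
  have hc0 : c ≠ 0 := by omega
  have ha0 : a ≠ 0 := ha.ne'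
  have hb0 : b ≠ 0 := hb.ne'
  have hb2 : 2 ≤ b := by
    by_contra hlt
    have hb1 : b = 1 := by omega
    have ha1 : a = 1 := by omega
    omega
  have hneq : a ≠ b := by
    intro heq
    rw [heq] at hcop
    have : b = 1 := by simpa using hcop
    omega
  have hac : a.Coprime c := coprime_left_of_isABCTriple h
  have hbc : b.Coprime c := coprime_right_of_isABCTriple h
  have hac_le : a ≤ c := by omega
  have hbc_le : b ≤ c := by omega
  -- the sets of primes
  set Sa := a.primeFactors with hSa
  set Sb := b.primeFactors with hSb
  set Sc := c.primeFactors with hSc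
  set S := (a * b * c).primeFactors with hS
  set r : ℕ := S.card with hr
  have hSab : (a * b).primeFactors = Sa ∪ Sb := Nat.primeFactors_mul ha0 hb0
  have hSca : (c * a).primeFactors = Sc ∪ Sa := Nat.primeFactors_mul hc0 ha0
  have hScb : (c * b).primeFactors = Sc ∪ Sb := Nat.primeFactors_mul hc0 hb0
  have hSabc : S = Sa ∪ Sb ∪ Sc := by
    rw [hS, Nat.primeFactors_mul (mul_ne_zero ha0 hb0) hc0, hSab]
  have hdab : Disjoint Sa Sb := hcop.disjoint_primeFactors
  have hdac : Disjoint Sa Sc := hac.disjoint_primeFactors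
  have hdbc : Disjoint Sb Sc := hbc.disjoint_primeFactors
  have hSaS : Sa ⊆ S := by rw [hSabc]; exact Finset.subset_union_left.trans Finset.subset_union_left
  have hSbS : Sb ⊆ S := by rw [hSabc]; exact Finset.subset_union_right.trans Finset.subset_union_left
  have hScS : Sc ⊆ S := by rw [hSabc]; exact Finset.subset_union_right
  have hSprime : ∀ q ∈ S, q.Prime := fun q hq => Nat.prime_of_mem_primeFactors hq
  have hrsum : r = Sa.card + Sb.card + Sc.card := by
    rw [hr, hSabc, Finset.card_union_of_disjoint (Finset.disjoint_union_left.mpr ⟨hdac, hdbc⟩),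
      Finset.card_union_of_disjoint hdab]
  have hSbne : Sb.Nonempty := Nat.nonempty_primeFactors.mpr (by omega)
  have hScne : Sc.Nonempty := Nat.nonempty_primeFactors.mpr (by omega)
  have hr1 : 1 ≤ r := by rw [hr]; exact Finset.card_pos.mpr (hScne.mono hScS)
  -- the radical, in `ℕ` and in `ℝ`
  set G : ℝ := (rad a b c : ℝ) with hGdef
  have hradS : rad a b c = ∏ q ∈ S, q := by
    rw [rad_def, Nat.radical_eq_prod_primeFactors]
  have hradpos : 0 < rad a b c := by rw [rad_def]; exact Nat.radical_pos _
  have hGprod : G = ∏ q ∈ S, (q : ℝ) := by rw [hGdef, hradS]; push_cast; rfl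
  have hsubG : ∀ U : Finset ℕ, U ⊆ S → ∏ q ∈ U, (q : ℝ) ≤ G := by
    intro U hU
    have h1 : ∏ q ∈ U, q ∣ ∏ q ∈ S, q := Finset.prod_dvd_prod_of_subset U S _ hU
    have h2 : ∏ q ∈ U, q ≤ rad a b c := by rw [hradS]; exact Nat.le_of_dvd (hradS ▸ hradpos) h1
    have h3 := (Nat.cast_le (α := ℝ)).mpr h2
    rw [Nat.cast_prod] at h3
    rw [hGdef]; exact h3
  have hqG : ∀ q ∈ S, (q : ℝ) ≤ G := by
    intro q hq
    have := hsubG {q} (Finset.singleton_subset_iff.mpr hq)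
    rwa [Finset.prod_singleton] at this
  have hG4 : (4 : ℝ) ≤ G := by
    obtain ⟨qb, hqb⟩ := hSbne
    obtain ⟨qc, hqc⟩ := hScne
    have hqb2 : (2 : ℝ) ≤ qb := by exact_mod_cast (Nat.prime_of_mem_primeFactors hqb).two_le
    have hqc2 : (2 : ℝ) ≤ qc := by exact_mod_cast (Nat.prime_of_mem_primeFactors hqc).two_le
    have hne : qb ≠ qc := fun heq => Finset.disjoint_left.mp hdbc hqb (heq ▸ hqc)
    have hsub : ({qb, qc} : Finset ℕ) ⊆ S := by
      intro q hq
      rcases Finset.mem_insert.mp hq with rfl | hq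
      · exact hSbS hqb
      · rw [Finset.mem_singleton] at hq; rw [hq]; exact hScS hqc
    have := hsubG _ hsub
    rw [Finset.prod_pair hne] at this
    nlinarith
  have hG1 : (1 : ℝ) ≤ G := by linarith
  have hG0 : (0 : ℝ) < G := by linarith
  set LG : ℝ := Real.log G with hLG
  have hLG1 : 1 ≤ LG := by
    rw [hLG, ← Real.log_exp 1]
    apply Real.log_le_log (Real.exp_pos 1)
    have := Real.exp_one_lt_d9; linarith
  have hLG0 : 0 ≤ LG := by linarith
  have hlog4G : ∀ q ∈ S, Real.log ((max 4 q : ℕ) : ℝ) ≤ LG := by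
    intro q hq
    apply Real.log_le_log (by exact_mod_cast lt_of_lt_of_le (by norm_num) (le_max_left 4 q))
    have : ((max 4 q : ℕ) : ℝ) = max (4 : ℝ) (q : ℝ) := by push_cast; rfl
    rw [this]; exact max_le hG4 (hqG q hq)
  have h2LG : Real.log (2 * LG) ≤ LG := by
    -- `2 log G ≤ G`: `log(G/2) ≤ G/2 − 1` and `log 2 ≤ 1`
    have h1 : Real.log G ≤ G / 2 := by
      have h := Real.log_le_sub_one_of_pos (show (0 : ℝ) < G / 2 by linarith)
      rw [Real.log_div hG0.ne' two_ne_zero] at h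
      have := Real.log_two_lt_d9
      linarith
    rw [hLG]
    exact Real.log_le_log (by rw [← hLG]; linarith) (by linarith)
  -- the log-bundle `Y = log(6 log c) · (log G)²`
  set Lc : ℝ := Real.log (6 * Real.log c) with hLc
  have hc3r : (3 : ℝ) ≤ c := by exact_mod_cast hc3
  have hlogc1 : 1 ≤ Real.log c := by
    rw [← Real.log_exp 1]
    apply Real.log_le_log (Real.exp_pos 1)
    have := Real.exp_one_lt_d9; linarith
  have hB3 : (3 : ℝ) ≤ 6 * Real.log c := by linarith
  have hLc1 : 1 ≤ Lc := by
    rw [hLc, ← Real.log_exp 1]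
    apply Real.log_le_log (Real.exp_pos 1)
    have := Real.exp_one_lt_d9; linarith
  set Y : ℝ := Lc * LG ^ 2 with hY'
  have hY0 : 0 ≤ Y := by positivity
  -- the constant
  set C : ℝ := 2 * max (max 1 |c₅|) |c₆| with hC
  have hm1 : 1 ≤ max (max 1 |c₅|) |c₆| := le_max_of_le_left (le_max_left _ _)
  have hm5 : |c₅| ≤ max (max 1 |c₅|) |c₆| := (le_max_right 1 |c₅|).trans (le_max_left _ _)
  have hm6 : |c₆| ≤ max (max 1 |c₅|) |c₆| := le_max_right _ _
  have hc₅C : |c₅| ≤ C := by rw [hC]; linarith [abs_nonneg c₅]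
  have hc₆C : 2 * |c₆| ≤ C := by rw [hC]; linarith
  have hC0 : 0 ≤ C := by rw [hC]; linarith
  have hCr1 : 1 ≤ C * r := by
    have : (1 : ℝ) ≤ r := by exact_mod_cast hr1
    rw [hC]; nlinarith
  -- exponent bounds
  have heab : ∀ q ∈ (a * b).primeFactors, |(((2 * expDiff a b q : ℤ)) : ℝ)| ≤ 6 * Real.log c := by
    intro q hq
    have hq' := abs_expDiff_le ha0 hb0 hcop hac_le hbc_le q (Nat.prime_of_mem_primeFactors hq)
    push_cast
    rw [abs_mul, Nat.abs_ofNat]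
    linarith
  have heca : ∀ q ∈ (c * a).primeFactors, (|expDiff c a q| : ℝ) ≤ 6 * Real.log c := by
    intro q hq
    have := abs_expDiff_le hc0 ha0 hac.symm le_rfl hac_le q (Nat.prime_of_mem_primeFactors hq)
    linarith
  have hecb : ∀ q ∈ (c * b).primeFactors, (|expDiff c b q| : ℝ) ≤ 6 * Real.log c := by
    intro q hq
    have := abs_expDiff_le hc0 hb0 hbc.symm le_rfl hbc_le q (Nat.prime_of_mem_primeFactors hq)
    linarith
  -- **route through `c`** (13)
  have hRc : Real.log c ≤ (C * r) ^ (Sa.card + Sb.card) * (largestPrimeFactor c : ℝ) ^ 2 *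
      ((∏ q ∈ Sa, Real.log ((max 4 q : ℕ) : ℝ)) * ∏ q ∈ Sb, Real.log ((max 4 q : ℕ) : ℝ)) * Y := by
    have key := log_le_of_padicRoute c₅ hY hc₅C hG4 hB3 (fun q => 2 * expDiff a b q) hc0
      (Nat.Coprime.mul_right hac.symm hbc.symm)
      (by rw [hSab]; exact hSbne.mono Finset.subset_union_right)
      (show (a * b).primeFactors.card ≤ r by
        rw [hr]; exact Finset.card_le_card (by rw [hSab]; exact Finset.union_subset hSaS hSbS))
      (fun q hq => hqG q ((by rw [hSab]; exact Finset.union_subset hSaS hSbS :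
        (a * b).primeFactors ⊆ S) hq))
      (hsubG Sc hScS) heab
      (prod_zpow_two_mul_expDiff_ne_one ha0 hb0 hcop hneq)
      (fun p hp => le_padicValRat_route_c h hneq hp)
    rw [hSab, Finset.card_union_of_disjoint hdab, Finset.prod_union hdab] at key
    rw [hY', hLc, hLG]; exact key
  -- **route through `b`** (14)
  have hlogcb : Real.log c ≤ 4 * Real.log b := by
    have h2b : (c : ℝ) ≤ 2 * b := by exact_mod_cast (show c ≤ 2 * b by omega)
    have hb2r : (2 : ℝ) ≤ b := by exact_mod_cast hb2
    have hlog2b : Real.log 2 ≤ Real.log b := Real.log_le_log two_pos hb2r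
    calc Real.log c ≤ Real.log (2 * b) := Real.log_le_log (by positivity) h2b
      _ = Real.log 2 + Real.log b := Real.log_mul two_ne_zero (by positivity)
      _ ≤ 4 * Real.log b := by linarith [Real.log_nonneg (by linarith : (1:ℝ) ≤ b)]
  have hRb : Real.log c ≤ 4 * ((C * r) ^ (Sc.card + Sa.card) * (largestPrimeFactor b : ℝ) ^ 2 *
      ((∏ q ∈ Sc, Real.log ((max 4 q : ℕ) : ℝ)) * ∏ q ∈ Sa, Real.log ((max 4 q : ℕ) : ℝ)) * Y) := by
    have key := log_le_of_padicRoute c₅ hY hc₅C hG4 hB3 (expDiff c a) hb0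
      (Nat.Coprime.mul_right hbc hcop.symm)
      (by rw [hSca]; exact hScne.mono Finset.subset_union_left)
      (show (c * a).primeFactors.card ≤ r by
        rw [hr]; exact Finset.card_le_card (by rw [hSca]; exact Finset.union_subset hScS hSaS))
      (fun q hq => hqG q ((by rw [hSca]; exact Finset.union_subset hScS hSaS :
        (c * a).primeFactors ⊆ S) hq))
      (hsubG Sb hSbS) heca
      (prod_zpow_expDiff_ne_one hc0 ha0 hac.symm (by omega))
      (fun p hp => by exact_mod_cast (padicValRat_route_b h hp).symm.le)
    rw [hSca, Finset.card_union_of_disjoint hdac.symm, Finset.prod_union hdac.symm] at key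
    rw [hY', hLc, hLG]
    exact hlogcb.trans (by linarith)
  -- **route through `a`** (16)
  have hRa : Real.log c ≤ 16 * ((C * r) ^ (Sc.card + Sb.card) * (largestPrimeFactor a : ℝ) ^ 2 *
      ((∏ q ∈ Sc, Real.log ((max 4 q : ℕ) : ℝ)) * ∏ q ∈ Sb, Real.log ((max 4 q : ℕ) : ℝ)) * Y) := by
    have hncard : (c * b).primeFactors.card = Sc.card + Sb.card := by
      rw [hScb, Finset.card_union_of_disjoint hdbc.symm]
    have hPLeq : ∏ q ∈ (c * b).primeFactors, Real.log ((max 4 q : ℕ) : ℝ) =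
        (∏ q ∈ Sc, Real.log ((max 4 q : ℕ) : ℝ)) * ∏ q ∈ Sb, Real.log ((max 4 q : ℕ) : ℝ) := by
      rw [hScb, Finset.prod_union hdbc.symm]
    have hncr : (c * b).primeFactors.card ≤ r := by rw [hncard, hrsum]; omega
    have hPa1 : (1 : ℝ) ≤ (largestPrimeFactor a : ℝ) ^ 2 := by
      have : (1 : ℝ) ≤ largestPrimeFactor a := by exact_mod_cast one_le_largestPrimeFactor a
      nlinarith
    by_cases hcase : b ≤ a ^ 2
    · -- `log a ≥ log b / 2 ≥ log c / 8`
      have hloga : Real.log c ≤ 8 * Real.log a := by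
        have h1 : (b : ℝ) ≤ (a : ℝ) ^ 2 := by exact_mod_cast hcase
        have h2 : Real.log b ≤ 2 * Real.log a := by
          have e : Real.log ((a : ℝ) ^ 2) = 2 * Real.log a := by rw [Real.log_pow]; norm_num
          rw [← e]
          exact Real.log_le_log (by exact_mod_cast hb) h1
        linarith
      have key := log_le_of_padicRoute c₅ hY hc₅C hG4 hB3 (expDiff c b) ha0
        (Nat.Coprime.mul_right hac hcop) (by rw [hScb]; exact hScne.mono Finset.subset_union_left)
        hncr
        (fun q hq => hqG q ((by rw [hScb]; exact Finset.union_subset hScS hSbS :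
          (c * b).primeFactors ⊆ S) hq))
        (hsubG Sa hSaS) hecb
        (prod_zpow_expDiff_ne_one hc0 hb0 hbc.symm (by omega))
        (fun p hp => by exact_mod_cast (padicValRat_route_a h hp).symm.le)
      rw [hncard, hPLeq] at key
      rw [hY', hLc, hLG]
      have h0 : 0 ≤ (C * r) ^ (Sc.card + Sb.card) * (largestPrimeFactor a : ℝ) ^ 2 *
          ((∏ q ∈ Sc, Real.log ((max 4 q : ℕ) : ℝ)) * ∏ q ∈ Sb, Real.log ((max 4 q : ℕ) : ℝ)) *
          (Real.log (6 * Real.log c) * Real.log G ^ 2) := by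
        rw [← hLc, ← hLG]
        have : 0 ≤ (C * r) ^ (Sc.card + Sb.card) := pow_nonneg (by positivity) _
        have := one_le_prod_log_max_four Sc
        have := one_le_prod_log_max_four Sb
        positivity
      linarith
    · push Not at hcase
      have key := log_le_of_archRoute Cw c₆ hCw hCwle hW₂ hc₆C hCr1 hLG1 h2LG h hab hc3 hcase hncr
        (fun q hq => hlog4G q ((by rw [hScb]; exact Finset.union_subset hScS hSbS :
          (c * b).primeFactors ⊆ S) hq))
      rw [hncard, hPLeq] at key
      rw [hY', hLc, hLG]
      refine key.trans ?_
      rw [← hLc, ← hLG, ← hY']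
      have h0 : 0 ≤ (C * r) ^ (Sc.card + Sb.card) *
          ((∏ q ∈ Sc, Real.log ((max 4 q : ℕ) : ℝ)) * ∏ q ∈ Sb, Real.log ((max 4 q : ℕ) : ℝ)) * Y := by
        have : 0 ≤ (C * r) ^ (Sc.card + Sb.card) := pow_nonneg (by positivity) _
        have := one_le_prod_log_max_four Sc
        have := one_le_prod_log_max_four Sb
        positivity
      calc 16 * ((C * r) ^ (Sc.card + Sb.card) *
            ((∏ q ∈ Sc, Real.log ((max 4 q : ℕ) : ℝ)) * ∏ q ∈ Sb, Real.log ((max 4 q : ℕ) : ℝ)) * Y)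
          = 16 * ((C * r) ^ (Sc.card + Sb.card) * 1 *
            ((∏ q ∈ Sc, Real.log ((max 4 q : ℕ) : ℝ)) * ∏ q ∈ Sb, Real.log ((max 4 q : ℕ) : ℝ)) * Y) := by
              ring
        _ ≤ 16 * ((C * r) ^ (Sc.card + Sb.card) * (largestPrimeFactor a : ℝ) ^ 2 *
            ((∏ q ∈ Sc, Real.log ((max 4 q : ℕ) : ℝ)) * ∏ q ∈ Sb, Real.log ((max 4 q : ℕ) : ℝ)) * Y) := by
              apply mul_le_mul_of_nonneg_left _ (by norm_num)
              apply mul_le_mul_of_nonneg_right _ hY0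
              apply mul_le_mul_of_nonneg_right _ (by
                have := one_le_prod_log_max_four Sc
                have := one_le_prod_log_max_four Sb
                positivity)
              exact mul_le_mul_of_nonneg_left hPa1 (pow_nonneg (by positivity) _)
  -- **(17): the product of the three routes**
  have h17 := pow_three_le_of_routes (Real.log_nonneg (by linarith)) (by positivity)
    (zero_le_one.trans (one_le_prod_log_max_four Sa)) (zero_le_one.trans (one_le_prod_log_max_four Sb))
    (zero_le_one.trans (one_le_prod_log_max_four Sc)) hY0 hRc hRb hRa
  -- the top primes `T = {p_a, p_b, p_c} ∩ S`
  set T : Finset ℕ := Sa.filter (fun q => q = largestPrimeFactor a) ∪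
    Sb.filter (fun q => q = largestPrimeFactor b) ∪ Sc.filter (fun q => q = largestPrimeFactor c)
    with hT
  have hTa : Sa.filter (fun q => q = largestPrimeFactor a) ⊆ Sa := Finset.filter_subset _ _
  have hTb : Sb.filter (fun q => q = largestPrimeFactor b) ⊆ Sb := Finset.filter_subset _ _
  have hTc : Sc.filter (fun q => q = largestPrimeFactor c) ⊆ Sc := Finset.filter_subset _ _
  have hdTab : Disjoint (Sa.filter (fun q => q = largestPrimeFactor a))
      (Sb.filter (fun q => q = largestPrimeFactor b)) := hdab.mono hTa hTb
  have hdTabc : Disjoint (Sa.filter (fun q => q = largestPrimeFactor a) ∪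
      Sb.filter (fun q => q = largestPrimeFactor b)) (Sc.filter (fun q => q = largestPrimeFactor c)) :=
    Finset.disjoint_union_left.mpr ⟨hdac.mono hTa hTc, hdbc.mono hTb hTc⟩
  have hTS : T ⊆ S := by
    rw [hT]
    exact Finset.union_subset (Finset.union_subset (hTa.trans hSaS) (hTb.trans hSbS)) (hTc.trans hScS)
  have hT3 : T.card ≤ 3 := by
    rw [hT]
    calc _ ≤ (Sa.filter (fun q => q = largestPrimeFactor a) ∪
          Sb.filter (fun q => q = largestPrimeFactor b)).card +
          (Sc.filter (fun q => q = largestPrimeFactor c)).card := Finset.card_union_le _ _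
      _ ≤ (Sa.filter (fun q => q = largestPrimeFactor a)).card +
          (Sb.filter (fun q => q = largestPrimeFactor b)).card +
          (Sc.filter (fun q => q = largestPrimeFactor c)).card := by
            gcongr; exact Finset.card_union_le _ _
      _ ≤ 1 + 1 + 1 := by
            gcongr
            · exact card_filter_eq_largestPrimeFactor_le a
            · exact card_filter_eq_largestPrimeFactor_le b
            · exact card_filter_eq_largestPrimeFactor_le c
  have hTprod : ∏ q ∈ T, (q : ℝ) =
      (largestPrimeFactor a : ℝ) * largestPrimeFactor b * largestPrimeFactor c := by
    rw [hT, Finset.prod_union hdTabc, Finset.prod_union hdTab, prod_filter_eq_largestPrimeFactor,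
      prod_filter_eq_largestPrimeFactor, prod_filter_eq_largestPrimeFactor]
  -- Lemma 4 without the top primes
  have hPLS : ∏ q ∈ S, Real.log ((max 4 q : ℕ) : ℝ) = (∏ q ∈ Sa, Real.log ((max 4 q : ℕ) : ℝ)) *
      (∏ q ∈ Sb, Real.log ((max 4 q : ℕ) : ℝ)) * ∏ q ∈ Sc, Real.log ((max 4 q : ℕ) : ℝ) := by
    rw [hSabc, Finset.prod_union (Finset.disjoint_union_left.mpr ⟨hdac, hdbc⟩), Finset.prod_union hdab]
  have h18 := pow_card_mul_prod_top_mul_prod_log_le hSprime hTS hT3 hLG1 hlog4G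
  rw [hTprod, hPLS, ← hGprod, ← hr] at h18
  -- assemble
  set X : ℝ := (r : ℝ) ^ r * ((largestPrimeFactor a : ℝ) * largestPrimeFactor b * largestPrimeFactor c) *
    ((∏ q ∈ Sa, Real.log ((max 4 q : ℕ) : ℝ)) * (∏ q ∈ Sb, Real.log ((max 4 q : ℕ) : ℝ)) *
      ∏ q ∈ Sc, Real.log ((max 4 q : ℕ) : ℝ)) with hX
  have hX0 : 0 ≤ X := by
    have := one_le_prod_log_max_four Sa
    have := one_le_prod_log_max_four Sb
    have := one_le_prod_log_max_four Sc
    positivity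
  have hXle : X ≤ 600 ^ (r + 1) * G * LG ^ 3 := h18
  have hmain : Real.log c ^ 3 ≤ 64 * Y ^ 3 * ((C ^ r) ^ 2 * X ^ 2) := by
    have e1 : (C * (r : ℝ)) ^ (Sa.card + Sb.card + Sc.card) = C ^ r * (r : ℝ) ^ r := by
      rw [← hrsum, mul_pow]
    have h17' := h17
    rw [e1] at h17'
    calc Real.log c ^ 3 ≤ _ := h17'
      _ = 64 * Y ^ 3 * ((C ^ r) ^ 2 * X ^ 2) := by rw [hX]; ring
  have hX2 : X ^ 2 ≤ (600 ^ (r + 1) * G * LG ^ 3) ^ 2 := pow_le_pow_left₀ hX0 hXle 2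
  have hCr2 : 0 ≤ (C ^ r) ^ 2 := by positivity
  have e3 : ((600 * C) ^ 2) ^ r = ((600 : ℝ) ^ r) ^ 2 * (C ^ r) ^ 2 := by
    rw [← mul_pow, ← mul_pow, ← pow_mul, ← pow_mul, mul_comm 2 r]
  calc Real.log c ^ 3 ≤ 64 * Y ^ 3 * ((C ^ r) ^ 2 * X ^ 2) := hmain
    _ ≤ 64 * Y ^ 3 * ((C ^ r) ^ 2 * (600 ^ (r + 1) * G * LG ^ 3) ^ 2) := by
        apply mul_le_mul_of_nonneg_left (mul_le_mul_of_nonneg_left hX2 hCr2) (by positivity)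
    _ = 23040000 * ((600 * C) ^ 2) ^ r * G ^ 2 * LG ^ 12 * Lc ^ 3 := by
        rw [hY', e3]; ring

end Main

/-! ### The theorem -/

section Theorem

variable (Cw : ℕ → ℝ)

/-- **Stewart–Yu 1991 from its two cited inputs, along the printed proof.** The named fact
`stewartYu1991_upperBound` (for every `ε > 0`: `log c ≤ κ(ε) · R^{2/3+ε}` for all abc triples
with `c ≥ c₀(ε)`, `R = rad(abc)`; the paper's corollary "in particular, for each `ε > 0` …
`z < exp(c₄(ε) G^{2/3+ε})`" of its Theorem `log z < G^{2/3 + c/log log G}`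
[cite: StewartYu1991, Theorem (p. 226)]) follows from
(Y) Lemma 1 of the paper (Yu 1990, Corollary 2.3 / Lemma 1.4, with the Kummer condition of
    Lemma 3) in the form applied in (10)–(12), the binder `hY` — an `nⁿ`-quality bound with `p²`
    and the product of the `log` of the generators [cite: StewartYu1991, Lemma 1]
    [cite: Yu1990, Corollary 2.3 (p. 32)], and
(W) Lemma 2 of the paper = Waldschmidt 1980, Proposition 3.8 for `K = ℚ`, `q = 2`, `E = 2`
    (binder `hW₂`, verbatim that of `BakerMethodBoundsKummerArchProofs`) with any constant
    `0 ≤ Cw(n) ≤ (c₆ n)ⁿ` (Waldschmidt: `C₁(n, 2) ≤ 2^{9n+27} n^{n+4}`, see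
    `stewartYu1991_of_yu1990_waldschmidt1980_explicit`) [cite: StewartYu1991, Lemma 2]
    [cite: Waldschmidt1980, Prop 3.8 (p. 274)].
Proof: `log_pow_three_le_of_yu1990_waldschmidt1980` ((17)–(18) of the paper), then
`D^r ≤ A(ε) G^ε` (Lemma 4 once more, `exists_pow_le_mul_rpow`), `(log G)^{12} ≤ (12/ε)^{12} G^ε`,
and the resolution of `u³ ≤ K³ G^{2+2ε} log(6u)³` (`le_of_pow_three_le_log`); here `c₀ = 3`.
Compare `stewartYu1991_of_yu` (`BakerMethodBoundsHalfExponentProofs`): the `Kⁿ`-quality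
`p`-adic theorem of Yu (2007) alone also suffices; the present inputs are those of 1991.
[cite: StewartYu1991, §3] -/
theorem stewartYu1991_of_yu1990_waldschmidt1980 (c₅ c₆ : ℝ)
    (hCw : ∀ n, 0 ≤ Cw n) (hCwle : ∀ n, Cw n ≤ (c₆ * n) ^ n)
    (hY : ∀ (p : ℕ), p.Prime → ∀ (S : Finset ℕ), (∀ q ∈ S, q.Prime) → p ∉ S → S.Nonempty →
      ∀ (e : ℕ → ℤ) (B : ℝ), 3 ≤ B → (∀ q ∈ S, (|e q| : ℝ) ≤ B) →
      ∏ q ∈ S, (q : ℚ) ^ e q ≠ 1 →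
      (padicValRat p (∏ q ∈ S, (q : ℚ) ^ e q - 1) : ℝ) <
        (c₅ * S.card) ^ S.card * (p : ℝ) ^ 2 * Real.log B *
          Real.log (Real.log ((max 4 (S.sup id) : ℕ) : ℝ)) *
          ∏ q ∈ S, Real.log ((max 4 q : ℕ) : ℝ))
    (hW₂ : ∀ (n : ℕ) (α : Fin (n + 1) → ℚ) (b : Fin (n + 1) → ℤ) (V : Fin (n + 1) → ℝ) (W : ℝ),
      (∀ j, 0 < α j ∧ α j ≠ 1) →
      Module.finrank ℚ ↥(IntermediateField.adjoin ℚ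
          (Set.range fun j => Real.sqrt (α j : ℝ))) = 2 ^ (n + 1) →
      Monotone V → 1 ≤ V 0 →
      (∀ j, max (logHeight₁ (α j)) |Real.log (α j : ℝ)| ≤ V j) →
      0 < W → (∀ j, logHeight₁ (b j : ℚ) ≤ W) →
      ∑ j, (b j : ℝ) * Real.log (α j : ℝ) ≠ 0 →
      Real.exp (-(Cw (n + 1) * (∏ j, V j) * (W + Real.log (2 * V (Fin.last n))) *
          Real.log (2 * (if n = 0 then 1 else V ⟨n - 1, by omega⟩)) / Real.log 2 ^ (n + 2))) <
        |∑ j, (b j : ℝ) * Real.log (α j : ℝ)|) :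
    stewartYu1991_upperBound := by
  intro ε' hε'
  -- the parameters `ε`, `C`, `D`, `A`, `K`, `θ`, `κ`
  set ε : ℝ := min (1 / 2) (3 * ε' / 8) with hεdef
  have hε0 : 0 < ε := lt_min (by norm_num) (by positivity)
  have hε2 : ε ≤ 1 / 2 := min_le_left _ _
  have hε38 : ε ≤ 3 * ε' / 8 := min_le_right _ _
  set C : ℝ := 2 * max (max 1 |c₅|) |c₆| with hC
  have hm1 : 1 ≤ max (max 1 |c₅|) |c₆| := le_max_of_le_left (le_max_left _ _)
  have hC1 : 1 ≤ C := by rw [hC]; linarith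
  set D : ℝ := (600 * C) ^ 2 with hD
  have hD1 : 1 ≤ D := by rw [hD]; exact one_le_pow₀ (by linarith)
  obtain ⟨A, hA1, hA⟩ := exists_pow_le_mul_rpow hD1 (show (1 : ℝ) ≤ 600 by norm_num) hε0
  set K₀ : ℝ := 23040000 * A * (12 / ε) ^ 12 with hK₀
  have h12ε : 1 ≤ 12 / ε := by rw [le_div_iff₀ hε0]; linarith
  have hK₀1 : 1 ≤ K₀ := by
    rw [hK₀]
    have h1 : (1 : ℝ) ≤ 23040000 * A := by nlinarith
    exact one_le_mul_of_one_le_of_one_le h1 (one_le_pow₀ h12ε)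
  set K : ℝ := K₀ ^ (1 / 3 : ℝ) with hK
  have hK1 : 1 ≤ K := Real.one_le_rpow hK₀1 (by norm_num)
  have hK3 : K ^ 3 = K₀ := by
    rw [hK, ← Real.rpow_natCast, ← Real.rpow_mul (by linarith)]; norm_num
  set θ : ℝ := (2 + 2 * ε) / 3 with hθ
  set κ : ℝ := (6 * K / ε) ^ (1 / (1 - ε)) with hκ
  have hκ0 : 0 ≤ κ := Real.rpow_nonneg (by positivity) _
  have hexp : θ / (1 - ε) ≤ 2 / 3 + ε' := by
    rw [div_le_iff₀ (by linarith), hθ]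
    have h1 : ε' * ε ≤ ε' / 2 := by nlinarith
    nlinarith
  refine ⟨κ, 3, ?_⟩
  suffices main : ∀ a b c : ℕ, IsABCTriple a b c → a ≤ b → (3 : ℝ) ≤ c →
      Real.log c ≤ κ * (rad a b c : ℝ) ^ (2 / 3 + ε' : ℝ) by
    intro a b c h hc
    rcases le_total a b with hab | hba
    · exact main a b c h hab hc
    · have := main b a c h.swap hba hc
      rwa [rad_swap] at this
  intro a b c h hab hc3r
  have hc3 : 3 ≤ c := by exact_mod_cast hc3r
  have hA' := log_pow_three_le_of_yu1990_waldschmidt1980 Cw c₅ c₆ hCw hCwle hY hW₂ h hab hc3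
  rw [← hC, ← hD] at hA'
  set G : ℝ := (rad a b c : ℝ) with hGdef
  set r : ℕ := (a * b * c).primeFactors.card with hr
  have hradpos : 0 < rad a b c := by rw [rad_def]; exact Nat.radical_pos _
  have hG1 : (1 : ℝ) ≤ G := by rw [hGdef]; exact_mod_cast hradpos
  have hG0 : (0 : ℝ) < G := by linarith
  -- `D^r ≤ A G^ε` (Lemma 4) and `(log G)^{12} ≤ (12/ε)^{12} G^ε`
  have hrr : (r : ℝ) ^ r ≤ 600 ^ (r + 1) * G := by
    have := card_pow_card_le_rad a b c
    rw [← hr] at this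
    exact this
  have hDr : D ^ r ≤ A * G ^ ε := hA r G hG1 hrr
  have hLG : Real.log G ^ 12 ≤ (12 / ε) ^ 12 * G ^ ε := by
    have h1 : Real.log G ≤ G ^ (ε / 12) / (ε / 12) := Real.log_le_rpow_div hG0.le (by positivity)
    have h2 : 0 ≤ Real.log G := Real.log_nonneg hG1
    have e : (G ^ (ε / 12)) ^ (12 : ℕ) = G ^ ε := by
      rw [← Real.rpow_natCast, ← Real.rpow_mul hG0.le]; congr 1; push_cast; ring
    calc Real.log G ^ 12 ≤ (G ^ (ε / 12) / (ε / 12)) ^ 12 := pow_le_pow_left₀ h2 h1 12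
      _ = (12 / ε) ^ 12 * G ^ ε := by rw [div_pow, e]; field_simp
  -- `(log c)³ ≤ K³ G^{3θ} log(6 log c)³`
  have hlogc1 : 1 ≤ Real.log c := by
    rw [← Real.log_exp 1]
    apply Real.log_le_log (Real.exp_pos 1)
    have := Real.exp_one_lt_d9; linarith
  have hLc0 : 0 ≤ Real.log (6 * Real.log c) := Real.log_nonneg (by linarith)
  have hGε : G ^ (3 * θ) = G ^ 2 * G ^ ε * G ^ ε := by
    rw [hθ, show (3 : ℝ) * ((2 + 2 * ε) / 3) = 2 + ε + ε by ring, Real.rpow_add hG0,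
      Real.rpow_add hG0, Real.rpow_two]
  have hcube : Real.log c ^ 3 ≤ K ^ 3 * G ^ (3 * θ) * Real.log (6 * Real.log c) ^ 3 := by
    calc Real.log c ^ 3 ≤ 23040000 * D ^ r * G ^ 2 * Real.log G ^ 12 * Real.log (6 * Real.log c) ^ 3 := hA'
      _ ≤ 23040000 * (A * G ^ ε) * G ^ 2 * ((12 / ε) ^ 12 * G ^ ε) * Real.log (6 * Real.log c) ^ 3 := by
          apply mul_le_mul_of_nonneg_right _ (pow_nonneg hLc0 3)
          apply mul_le_mul _ hLG (pow_nonneg (Real.log_nonneg hG1) 12) (by positivity)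
          exact mul_le_mul_of_nonneg_right (mul_le_mul_of_nonneg_left hDr (by norm_num)) (by positivity)
      _ = K ^ 3 * G ^ (3 * θ) * Real.log (6 * Real.log c) ^ 3 := by rw [hK3, hK₀, hGε]; ring
  have hfin := le_of_pow_three_le_log hK1 hε0 hε2 hlogc1 hG1 hcube
  calc Real.log c ≤ (6 * K / ε) ^ (1 / (1 - ε)) * G ^ (θ / (1 - ε)) := hfin
    _ ≤ κ * G ^ (2 / 3 + ε' : ℝ) := by
        rw [← hκ]
        exact mul_le_mul_of_nonneg_left (Real.rpow_le_rpow_of_exponent_le hG1 hexp) hκ0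

/-- **Waldschmidt's constant is of quality `nⁿ`:** `2^{9n+27} n^{n+4} ≤ (2^{40} n)ⁿ` (for `n ≥ 1`;
both sides read `0 ≤ 1` resp. `2^{27}·0 ≤ 1` at `n = 0`).
[cite: Waldschmidt1980, Prop 3.8 (p. 274)] -/
theorem waldschmidt_constant_le (n : ℕ) :
    (2 : ℝ) ^ (9 * n + 27) * (n : ℝ) ^ (n + 4) ≤ (2 ^ 40 * n) ^ n := by
  rcases Nat.eq_zero_or_pos n with rfl | hn
  · norm_num
  have h16 : (n : ℝ) ^ 4 ≤ 16 ^ n := by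
    have h : (n : ℝ) ≤ 2 ^ n := by exact_mod_cast (Nat.lt_two_pow_self (n := n)).le
    calc (n : ℝ) ^ 4 ≤ (2 ^ n) ^ 4 := pow_le_pow_left₀ (Nat.cast_nonneg _) h 4
      _ = 16 ^ n := by rw [← pow_mul, mul_comm, pow_mul]; norm_num
  have h1 : (2 : ℝ) ^ (9 * n + 27) ≤ 2 ^ (36 * n) := pow_le_pow_right₀ (by norm_num) (by omega)
  calc (2 : ℝ) ^ (9 * n + 27) * (n : ℝ) ^ (n + 4) = 2 ^ (9 * n + 27) * (n : ℝ) ^ 4 * (n : ℝ) ^ n := by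
        ring
    _ ≤ 2 ^ (36 * n) * 16 ^ n * (n : ℝ) ^ n := by
        apply mul_le_mul_of_nonneg_right _ (by positivity)
        exact mul_le_mul h1 h16 (by positivity) (by positivity)
    _ = (2 ^ 40 * n) ^ n := by
        rw [mul_pow, show (2 : ℝ) ^ 40 = 2 ^ 36 * 16 by norm_num, mul_pow, ← pow_mul, pow_mul]

/-- **The same with Waldschmidt's explicit constant.** Stewart–Yu 1991 from the binder `hY`
(Lemma 1 + Lemma 3 of the paper, as in `stewartYu1991_of_yu1990_waldschmidt1980`) and
Waldschmidt's Proposition 3.8 over `ℚ` with `q = 2`, `E = 2` and HIS constant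
`C₁(n, 2) ≤ 2^{6n+24} n^{n+4} 2^{3n+3} = 2^{9n+27} n^{n+4}` for `n` generators — so that, besides
the `p`-adic input `hY`, the remaining hypothesis is literally the printed Proposition 3.8
(`K = ℚ`, `D = 1`, `q = 2`) at `E = 2`. [cite: Waldschmidt1980, Prop 3.8 (p. 274)]
[cite: StewartYu1991, Theorem (p. 226), Lemma 2] -/
theorem stewartYu1991_of_yu1990_waldschmidt1980_explicit (c₅ : ℝ)
    (hY : ∀ (p : ℕ), p.Prime → ∀ (S : Finset ℕ), (∀ q ∈ S, q.Prime) → p ∉ S → S.Nonempty →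
      ∀ (e : ℕ → ℤ) (B : ℝ), 3 ≤ B → (∀ q ∈ S, (|e q| : ℝ) ≤ B) →
      ∏ q ∈ S, (q : ℚ) ^ e q ≠ 1 →
      (padicValRat p (∏ q ∈ S, (q : ℚ) ^ e q - 1) : ℝ) <
        (c₅ * S.card) ^ S.card * (p : ℝ) ^ 2 * Real.log B *
          Real.log (Real.log ((max 4 (S.sup id) : ℕ) : ℝ)) *
          ∏ q ∈ S, Real.log ((max 4 q : ℕ) : ℝ))
    (hW₂ : ∀ (n : ℕ) (α : Fin (n + 1) → ℚ) (b : Fin (n + 1) → ℤ) (V : Fin (n + 1) → ℝ) (W : ℝ),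
      (∀ j, 0 < α j ∧ α j ≠ 1) →
      Module.finrank ℚ ↥(IntermediateField.adjoin ℚ
          (Set.range fun j => Real.sqrt (α j : ℝ))) = 2 ^ (n + 1) →
      Monotone V → 1 ≤ V 0 →
      (∀ j, max (logHeight₁ (α j)) |Real.log (α j : ℝ)| ≤ V j) →
      0 < W → (∀ j, logHeight₁ (b j : ℚ) ≤ W) →
      ∑ j, (b j : ℝ) * Real.log (α j : ℝ) ≠ 0 →
      Real.exp (-((2 : ℝ) ^ (9 * (n + 1) + 27) * ((n + 1 : ℕ) : ℝ) ^ ((n + 1) + 4) * (∏ j, V j) *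
          (W + Real.log (2 * V (Fin.last n))) *
          Real.log (2 * (if n = 0 then 1 else V ⟨n - 1, by omega⟩)) / Real.log 2 ^ (n + 2))) <
        |∑ j, (b j : ℝ) * Real.log (α j : ℝ)|) :
    stewartYu1991_upperBound :=
  stewartYu1991_of_yu1990_waldschmidt1980 (fun n => (2 : ℝ) ^ (9 * n + 27) * (n : ℝ) ^ (n + 4))
    c₅ (2 ^ 40) (fun n => by positivity) (fun n => waldschmidt_constant_le n) hY
    (fun n α b V W h1 h2 h3 h4 h5 h6 h7 h8 => hW₂ n α b V W h1 h2 h3 h4 h5 h6 h7 h8)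

end Theorem

end Literature.Barriers.ABC

end
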